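import Mathlib
import HarnessLib
import Literature.MathematicalPhysics.StatisticalMechanics.RenormalisationMapLipschitzMaxGain
import Literature.MathematicalPhysics.StatisticalMechanics.RenormalisationMapRemaindersOneQ
import Literature.MathematicalPhysics.StatisticalMechanics.RenormalisationMapRemaindersTwoQ
import Literature.MathematicalPhysics.StatisticalMechanics.LinearisedMapBlockPartABKMQ

/-!
# The `S_k^{(q)}`-Lipschitz bound (raw, weak, gain, σ·max forms) for step data with a kernel BY PREDICATE
# ([ABKM19] Theorem 6.8 (6.59)–(6.60), `q ∈ B_κ`)

The `S_k`-Lipschitz bound of [ABKM19] Theorem 6.8 (6.59)–(6.60) and its packaged forms were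
landed for the step kernel EQUAL to the weight kernel `𝒞_{k+1}` (`q = 0`).  Of the kernel their proofs
use only the facts recorded in `StepKernelBounds` (`StepKernelBoundsABKM`) and `C₂ ≤ h²`.  This file is
the `q`-twin for step data with `StepKernelBounds W L k A𝒫' C₂ D.𝒞` relative to the `q = 0` weights
(constant `A_𝒫 ↦ A𝒫'`, including inside `largePartEps`/`gainConst`/`sigmaABKM`; `C₂ ≤ h²` in place of the
regularity-constant hypothesis):

* `tayNormLE_remainderOne_sub_abkm_block_of_stepKernelBounds`, **`tayNormLE_nextKStep_sub_abkm_raw_of_stepKernelBounds`**;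
* `weakNormLE_nextKStep_sub_abkm_of_stepKernelBounds`, **`weakNormLE_nextKStep_sub_abkm_gain_of_stepKernelBounds`**,
  **`weakNormLE_nextKStep_sub_abkm_max_gain_of_stepKernelBounds`**.

The `q = 0` statements are recovered with `AbkmWeightBounds.stepKernelBounds`.  Everything is proved;
no named fact.

## References
* S. Adams, S. Buchholz, R. Kotecký, S. Müller, arXiv:1910.13564, Theorem 6.8 ((6.59)–(6.60)),
  Lemmas 10.1–10.6, Lemma 7.7 [AdamsBuchholzKoteckyMuller2019].
-/

noncomputable section

namespace Literature.MathematicalPhysics.StatisticalMechanics.GradientRG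

open scoped BigOperators Classical
open Finset MeasureTheory
open Literature.MathematicalPhysics.StatisticalMechanics.TorusPolymer
  (IsPolymer blocks polys bprod blockOf thicken reblock boxCorner mem_polys mem_blocks numBlocks isPolymer_blockOf
    card_blocks_eq_numBlocks blocks_blockOf empty_mem_polys closure mem_blockOf_self)
open Literature.Barriers.CriticalPhenomena.LongRangePhi4.Polymer (IsConn components)
open Literature.MathematicalPhysics.StatisticalMechanics.GradientFRD (iterDiff)
open Literature.MathematicalPhysics.QuantumFieldTheory

variable {d M : ℕ} [NeZero M]

/-- **`Σ₁` on single `(k+1)`-blocks, `L^d` form**: the bound of `tayNormLE_remainderOne_sub_abkm_of_stepKernelBounds` for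
`H̃ = nextH D H K`, `H̃' = nextH D H' K'` (`‖H̃ − H̃'‖ ≤ 2‖H−H'‖ + v_Δ`, `‖H̃‖,‖H̃'‖ ≤ 2b + v` substituted) with the
block count `|U|_k` replaced by `L^d` and multiplied by `A · A^{−|U|_{k+1}}`: the block sum is empty unless `U` is a
single `(k+1)`-block, where `|U|_k = L^d` and `A · A^{−|U|_{k+1}} = 1` — a constant uniform in `U`.
[cite: AdamsBuchholzKoteckyMuller2019, Theorem 6.8 / Lemma 9.6 (proof, first order)] -/
theorem tayNormLE_remainderOne_sub_abkm_block_of_stepKernelBounds {L N Mord R n p r₀ : ℕ} {θbar lam μ δ₁ δ₀ A𝒫 A𝒫' C₂ h A : ℝ}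
    {𝒞 : ℕ → (Fin d → ZMod M) → ℝ} (hd : 3 ≤ d) (hLodd : Odd L) (hL : 2 ^ (d + 3) + 16 * R ≤ L)
    (hR2 : 2 ≤ R) (hM : M = L ^ N) {k : ℕ} (hkN : k + 1 ≤ N)
    (hp1 : d / 2 + 1 ≤ p) (hpR : p ≤ R) (hMord : d / 2 + 1 ≤ Mord) (hr₀2 : 2 ≤ r₀)
   
    (hB : AbkmWeightBounds L N Mord R n θbar lam μ δ₁ δ₀ A𝒫 𝒞
      (abkmWeightData L N Mord R θbar (schedDelta δ₀ δ₁ N) 𝒞))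
    (hδ₀ : 0 < δ₀) (hδ₁ : 0 < δ₁) (hh : 0 < h) (hh0 : hZeroSq d R δ₀ δ₁ ≤ h ^ 2)
   
    (hh2 : C₂ ≤ h ^ 2) (hA𝒫 : 0 ≤ A𝒫') (hA1 : 1 ≤ A)
    (D : StepData d M) (hDs : D.s = L ^ k) (hDL : D.L = L) (hS : StepKernelBounds (abkmWeightData L N Mord R θbar (schedDelta δ₀ δ₁ N) 𝒞) L k A𝒫' C₂ D.𝒞)
    {x₀ : Fin d → ZMod M} (hB₀ : D.B₀ = blockOf (L ^ k) x₀) (hc₀ : D.c₀ = boxCorner (L ^ k) (starRad R L d k) x₀)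
    {U : Finset (Fin d → ZMod M)} (hU : IsPolymer (L ^ (k + 1)) U)
    {H H' : RelevantHamiltonian ℂ d} {b : ℝ}
    (hH : hamNorm (fieldWt h (L : ℝ) d k) ((L : ℝ) ^ k) (L ^ (d * k)) H ≤ b)
    (hH' : hamNorm (fieldWt h (L : ℝ) d k) ((L : ℝ) ^ k) (L ^ (d * k)) H' ≤ b) (hb : b ≤ 1 / 64)
    {K K' : Finset (Fin d → ZMod M) → ((Fin d → ZMod M) → ℝ) → ℂ} {C CΔ : ℝ} (hC : 0 ≤ C) (hCΔ : 0 ≤ CΔ)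
    (hK : WeakNormLE (abkmNormParams L N Mord R p r₀ h θbar A (schedDelta δ₀ δ₁ N) 𝒞) k K C)
    (hK' : WeakNormLE (abkmNormParams L N Mord R p r₀ h θbar A (schedDelta δ₀ δ₁ N) 𝒞) k K' C)
    (hΔ : WeakNormLE (abkmNormParams L N Mord R p r₀ h θbar A (schedDelta δ₀ δ₁ N) 𝒞) k (K - K') CΔ)
    (hKd : ∀ Y, ContDiff ℝ r₀ (K Y)) (hK'd : ∀ Y, ContDiff ℝ r₀ (K' Y))
    (hKloc : ∀ Y, IsPolymer (L ^ k) Y → IsConn Y → IsGaugeLocal ((abkmNormParams L N Mord R p r₀ h θbar A (schedDelta δ₀ δ₁ N) 𝒞).gauge k Y) (K Y))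
    (hK'loc : ∀ Y, IsPolymer (L ^ k) Y → IsConn Y → IsGaugeLocal ((abkmNormParams L N Mord R p r₀ h θbar A (schedDelta δ₀ δ₁ N) 𝒞).gauge k Y) (K' Y))
    (hv : pi2BoundConst d (((2 * R + 2 : ℕ) : ℝ) + ((d / 2 + 1 : ℕ) : ℝ)) * (C * A𝒫' * A⁻¹) ≤ 1 / 64)
    {κ : ℝ}
    (hκ1 : 1 + Real.exp (1 / 4) + 16 * Real.exp (3 / 8) * (2 * hamNorm (fieldWt h (L : ℝ) d k) ((L : ℝ) ^ k) (L ^ (d * k)) (H - H') + pi2BoundConst d (((2 * R + 2 : ℕ) : ℝ) + ((d / 2 + 1 : ℕ) : ℝ)) * (CΔ * A𝒫' * A⁻¹)) ≤ κ)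
    (hκ2 : 1 + Real.exp (1 / 4) + 16 * Real.exp (3 / 8) * (2 * b + pi2BoundConst d (((2 * R + 2 : ℕ) : ℝ) + ((d / 2 + 1 : ℕ) : ℝ)) * (C * A𝒫' * A⁻¹)) ≤ κ) :
    TayNormLE ((abkmNormParams L N Mord R p r₀ h θbar A (schedDelta δ₀ δ₁ N) 𝒞).gauge (k + 1) U) r₀ ((abkmWeightData L N Mord R θbar (schedDelta δ₀ δ₁ N) 𝒞).weight (k + 1) U)
      (fun φ => (∑ B ∈ blockPartIndex D U,
        ((bprod (L ^ k) (fun B' => expNegH (nextH D H K) B' φ) (U \ B) *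
              bprod (L ^ k) (fun B' => expNegH (-(nextH D H K)) B' φ) (B \ U) - 1) * blockTerm D K B φ +
          bprod (L ^ k) (fun B' => expNegH (nextH D H K) B' φ) (U \ B) *
              bprod (L ^ k) (fun B' => expNegH (-(nextH D H K)) B' φ) (B \ U) *
            (fluctDefect D.𝒞 H B φ +
              (expNegH (stepOpA (gradCov D.𝒞) H) B φ - 1) * (1 - Complex.exp (-(eval (opB D K) B φ))) -
              (Complex.exp (-(eval (opB D K) B φ)) - 1 + eval (opB D K) B φ)) +
          bprod (L ^ k) (fun B' => expNegH (nextH D H K) B' φ) (U \ B) *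
              bprod (L ^ k) (fun B' => expNegH (-(nextH D H K)) B' φ) (B \ U) *
            fluct D.𝒞 (fun ψ => ∑ Y ∈ ((polys (L ^ k) B).erase B).erase ∅,
              bprod (L ^ k) (fun B' => expNegH H B' ψ - 1) (B \ Y) * K Y ψ) φ)) -
        (∑ B ∈ blockPartIndex D U,
        ((bprod (L ^ k) (fun B' => expNegH (nextH D H' K') B' φ) (U \ B) *
              bprod (L ^ k) (fun B' => expNegH (-(nextH D H' K')) B' φ) (B \ U) - 1) * blockTerm D K' B φ +
          bprod (L ^ k) (fun B' => expNegH (nextH D H' K') B' φ) (U \ B) *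
              bprod (L ^ k) (fun B' => expNegH (-(nextH D H' K')) B' φ) (B \ U) *
            (fluctDefect D.𝒞 H' B φ +
              (expNegH (stepOpA (gradCov D.𝒞) H') B φ - 1) * (1 - Complex.exp (-(eval (opB D K') B φ))) -
              (Complex.exp (-(eval (opB D K') B φ)) - 1 + eval (opB D K') B φ)) +
          bprod (L ^ k) (fun B' => expNegH (nextH D H' K') B' φ) (U \ B) *
              bprod (L ^ k) (fun B' => expNegH (-(nextH D H' K')) B' φ) (B \ U) *
            fluct D.𝒞 (fun ψ => ∑ Y ∈ ((polys (L ^ k) B).erase B).erase ∅,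
              bprod (L ^ k) (fun B' => expNegH H' B' ψ - 1) (B \ Y) * K' Y ψ) φ)))
      (((L ^ d : ℕ) : ℝ) * κ ^ (L ^ d) * ((16 * Real.exp (3 / 8) * (2 * hamNorm (fieldWt h (L : ℝ) d k) ((L : ℝ) ^ k) (L ^ (d * k)) (H - H') + pi2BoundConst d (((2 * R + 2 : ℕ) : ℝ) + ((d / 2 + 1 : ℕ) : ℝ)) * (CΔ * A𝒫' * A⁻¹))) * (((1 + 8 * pi2BoundConst d (((2 * R + 2 : ℕ) : ℝ) + ((d / 2 + 1 : ℕ) : ℝ))) * (C * A𝒫' * A⁻¹)) + 256 * Real.exp (1 / 4) * ((A𝒫' + 4) * b ^ 2 + 2 * b * (pi2BoundConst d (((2 * R + 2 : ℕ) : ℝ) + ((d / 2 + 1 : ℕ) : ℝ)) * (C * A𝒫' * A⁻¹)) + (pi2BoundConst d (((2 * R + 2 : ℕ) : ℝ) + ((d / 2 + 1 : ℕ) : ℝ)) * (C * A𝒫' * A⁻¹)) ^ 2)) + 16 * Real.exp (3 / 8) * (2 * b + pi2BoundConst d (((2 * R + 2 : ℕ) : ℝ) + ((d / 2 + 1 :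 ℕ) : ℝ)) * (C * A𝒫' * A⁻¹)) * ((1 + 8 * pi2BoundConst d (((2 * R + 2 : ℕ) : ℝ) + ((d / 2 + 1 : ℕ) : ℝ))) * (CΔ * A𝒫' * A⁻¹)) + (512 * Real.exp (1 / 4) * (A𝒫' + 4) * (b + b) * hamNorm (fieldWt h (L : ℝ) d k) ((L : ℝ) ^ k) (L ^ (d * k)) (H - H') + 512 * Real.exp (1 / 4) * (hamNorm (fieldWt h (L : ℝ) d k) ((L : ℝ) ^ k) (L ^ (d * k)) (H - H') * (pi2BoundConst d (((2 * R + 2 : ℕ) : ℝ) + ((d / 2 + 1 : ℕ) : ℝ)) * (C * A𝒫' * A⁻¹)) + b * (pi2BoundConst d (((2 * R + 2 : ℕ) : ℝ) + ((d / 2 + 1 : ℕ) : ℝ)) * (CΔ * A𝒫' * A⁻¹))) + 256 * Real.exp (1 / 4) * (pi2BoundConst d (((2 * R + 2 : ℕ) : ℝ) + ((d / 2 + 1 : ℕ) : ℝ)) * (C * A𝒫' * A⁻¹) + pi2BoundConst d (((2 * R + 2 : ℕ) : ℝ) + ((d / 2 + 1 : ℕ) : ℝ)) * (CΔ * A𝒫'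 * A⁻¹)) * (pi2BoundConst d (((2 * R + 2 : ℕ) : ℝ) + ((d / 2 + 1 : ℕ) : ℝ)) * (CΔ * A𝒫' * A⁻¹)))) * (A * (abkmNormParams L N Mord R p r₀ h θbar A (schedDelta δ₀ δ₁ N) 𝒞).aFactor (k + 1) U)) := by
  set P := abkmNormParams L N Mord R p r₀ h θbar A (schedDelta δ₀ δ₁ N) 𝒞 with hP
  set W := abkmWeightData L N Mord R θbar (schedDelta δ₀ δ₁ N) 𝒞 with hW
  have hd2 : 2 ≤ d := by omega
  have hL0 : (0 : ℝ) < L := by exact_mod_cast hLodd.pos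
  have hA0 : 0 < A := by linarith
  have hk1 : k + 1 ≤ N + 1 := by omega
  have h𝔥 : 0 < fieldWt h (L : ℝ) d k := fieldWt_pos hh hL0 d k
  have hRk : (0 : ℝ) < (L : ℝ) ^ k := by positivity
  have hnn : ∀ G : RelevantHamiltonian ℂ d, 0 ≤ hamNorm (fieldWt h (L : ℝ) d k) ((L : ℝ) ^ k) (L ^ (d * k)) G :=
    fun G => hamNorm_nonneg h𝔥.le hRk.le _ _
  have hb0 : 0 ≤ b := (hnn H).trans hH
  have hC87_0 : 0 ≤ pi2BoundConst d (((2 * R + 2 : ℕ) : ℝ) + ((d / 2 + 1 : ℕ) : ℝ)) := pi2BoundConst_nonneg d (by positivity)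
  have hAinv : 0 ≤ A⁻¹ := inv_nonneg.2 hA0.le
  have hv0 : 0 ≤ pi2BoundConst d (((2 * R + 2 : ℕ) : ℝ) + ((d / 2 + 1 : ℕ) : ℝ)) * (C * A𝒫' * A⁻¹) := by positivity
  have hvΔ0 : 0 ≤ pi2BoundConst d (((2 * R + 2 : ℕ) : ℝ) + ((d / 2 + 1 : ℕ) : ℝ)) * (CΔ * A𝒫' * A⁻¹) := by positivity
  have hnHH0 := hnn (H - H')
  have he38 : 0 ≤ 16 * Real.exp (3 / 8) := by positivity
  have he14 : 0 ≤ 8 * Real.exp (1 / 4) := by positivity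
  have hHt0 := hamNorm_nextH_abkm_le_of_stepKernelBounds hd2 hLodd hL hM hkN hp1 hpR hr₀2 hB hh hh2 hA1 D hS hB₀ hc₀ H
    hC hK hKd hKloc
  have hHt'0 := hamNorm_nextH_abkm_le_of_stepKernelBounds hd2 hLodd hL hM hkN hp1 hpR hr₀2 hB hh hh2 hA1 D hS hB₀ hc₀ H'
    hC hK' hK'd hK'loc
  have hΔle := hamNorm_nextH_sub_abkm_le_of_stepKernelBounds hd2 hLodd hL hM hkN hp1 hpR hr₀2 hB hh hh2 hA1 D hS hB₀ hc₀
    H H' hC hC hCΔ hK hK' hΔ hKd hK'd hKloc hK'loc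
  have hHt : hamNorm (fieldWt h (L : ℝ) d k) ((L : ℝ) ^ k) (L ^ (d * k)) (nextH D H K) ≤ (2 * b + pi2BoundConst d (((2 * R + 2 : ℕ) : ℝ) + ((d / 2 + 1 : ℕ) : ℝ)) * (C * A𝒫' * A⁻¹)) := by
    linarith [hHt0, hH]
  have hHt' : hamNorm (fieldWt h (L : ℝ) d k) ((L : ℝ) ^ k) (L ^ (d * k)) (nextH D H' K') ≤ (2 * b + pi2BoundConst d (((2 * R + 2 : ℕ) : ℝ) + ((d / 2 + 1 : ℕ) : ℝ)) * (C * A𝒫' * A⁻¹)) := by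
    linarith [hHt'0, hH']
  have hτ : (2 * b + pi2BoundConst d (((2 * R + 2 : ℕ) : ℝ) + ((d / 2 + 1 : ℕ) : ℝ)) * (C * A𝒫' * A⁻¹)) ≤ 1 / 16 := by linarith [hb, hv]
  have hτ0 : 0 ≤ (2 * b + pi2BoundConst d (((2 * R + 2 : ℕ) : ℝ) + ((d / 2 + 1 : ℕ) : ℝ)) * (C * A𝒫' * A⁻¹)) := by positivity
  have hΔt : 16 * Real.exp (3 / 8) * hamNorm (fieldWt h (L : ℝ) d k) ((L : ℝ) ^ k) (L ^ (d * k)) (nextH D H K - nextH D H' K') ≤ 16 * Real.exp (3 / 8) * (2 * hamNorm (fieldWt h (L : ℝ) d k) ((L : ℝ) ^ k) (L ^ (d * k)) (H - H') + pi2BoundConst d (((2 * R + 2 : ℕ) : ℝ) + ((d / 2 + 1 : ℕ) : ℝ)) * (CΔ * A𝒫' * A⁻¹)) :=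
    mul_le_mul_of_nonneg_left hΔle he38
  have hκ : 1 + Real.exp (1 / 4) + 16 * Real.exp (3 / 8) * hamNorm (fieldWt h (L : ℝ) d k) ((L : ℝ) ^ k) (L ^ (d * k)) (nextH D H K - nextH D H' K') ≤ κ := by
    linarith [hΔt, hκ1]
  have hκ0 : 0 ≤ κ := by
    have e1 : 0 ≤ 16 * Real.exp (3 / 8) * hamNorm (fieldWt h (L : ℝ) d k) ((L : ℝ) ^ k) (L ^ (d * k)) (nextH D H K - nextH D H' K') := mul_nonneg he38 (hnn _)
    linarith [hκ, Real.exp_pos (1 / 4)]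
  have hκm0 : 0 ≤ κ ^ (blocks (L ^ k) U).card := pow_nonneg hκ0 _
  have hDP0 : 0 ≤ 16 * Real.exp (3 / 8) * (2 * hamNorm (fieldWt h (L : ℝ) d k) ((L : ℝ) ^ k) (L ^ (d * k)) (H - H') + pi2BoundConst d (((2 * R + 2 : ℕ) : ℝ) + ((d / 2 + 1 : ℕ) : ℝ)) * (CΔ * A𝒫' * A⁻¹)) := by positivity
  have hMo : Odd M := by rw [hM]; exact hLodd.pow
  have hsodd : Odd (L ^ k) := hLodd.pow
  have hM00 : (0 : ℝ) ≤ ((blocks (L ^ k) U).card : ℝ) := Nat.cast_nonneg _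
  have hg1_0 : 0 ≤ ((1 + 8 * pi2BoundConst d (((2 * R + 2 : ℕ) : ℝ) + ((d / 2 + 1 : ℕ) : ℝ))) * (C * A𝒫' * A⁻¹)) := by positivity
  have hgΦ0 : 0 ≤ 256 * Real.exp (1 / 4) * ((A𝒫' + 4) * b ^ 2 + 2 * b * (pi2BoundConst d (((2 * R + 2 : ℕ) : ℝ) + ((d / 2 + 1 : ℕ) : ℝ)) * (C * A𝒫' * A⁻¹)) + (pi2BoundConst d (((2 * R + 2 : ℕ) : ℝ) + ((d / 2 + 1 : ℕ) : ℝ)) * (C * A𝒫' * A⁻¹)) ^ 2) := by positivity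
  have hg0 : 0 ≤ ((1 + 8 * pi2BoundConst d (((2 * R + 2 : ℕ) : ℝ) + ((d / 2 + 1 : ℕ) : ℝ))) * (C * A𝒫' * A⁻¹)) + 256 * Real.exp (1 / 4) * ((A𝒫' + 4) * b ^ 2 + 2 * b * (pi2BoundConst d (((2 * R + 2 : ℕ) : ℝ) + ((d / 2 + 1 : ℕ) : ℝ)) * (C * A𝒫' * A⁻¹)) + (pi2BoundConst d (((2 * R + 2 : ℕ) : ℝ) + ((d / 2 + 1 : ℕ) : ℝ)) * (C * A𝒫' * A⁻¹)) ^ 2) := add_nonneg hg1_0 hgΦ0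
  have hρ1_0 : 0 ≤ ((1 + 8 * pi2BoundConst d (((2 * R + 2 : ℕ) : ℝ) + ((d / 2 + 1 : ℕ) : ℝ))) * (CΔ * A𝒫' * A⁻¹)) := by positivity
  have hρΦ0 : 0 ≤ (512 * Real.exp (1 / 4) * (A𝒫' + 4) * (b + b) * hamNorm (fieldWt h (L : ℝ) d k) ((L : ℝ) ^ k) (L ^ (d * k)) (H - H') + 512 * Real.exp (1 / 4) * (hamNorm (fieldWt h (L : ℝ) d k) ((L : ℝ) ^ k) (L ^ (d * k)) (H - H') * (pi2BoundConst d (((2 * R + 2 : ℕ) : ℝ) + ((d / 2 + 1 : ℕ) : ℝ)) * (C * A𝒫' * A⁻¹)) + b * (pi2BoundConst d (((2 * R + 2 : ℕ) : ℝ) + ((d / 2 + 1 : ℕ) : ℝ)) * (CΔ * A𝒫' * A⁻¹))) + 256 * Real.exp (1 / 4) * (pi2BoundConst d (((2 * R + 2 : ℕ) : ℝ) + ((d / 2 + 1 : ℕ) : ℝ)) * (C * A𝒫' * A⁻¹) + pi2BoundConst d (((2 * R + 2 : ℕ) : ℝ) + ((d / 2 + 1 : ℕ) : ℝ)) * (CΔ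 * A𝒫' * A⁻¹)) * (pi2BoundConst d (((2 * R + 2 : ℕ) : ℝ) + ((d / 2 + 1 : ℕ) : ℝ)) * (CΔ * A𝒫' * A⁻¹))) := by positivity
  have h1 := tayNormLE_remainderOne_sub_abkm_of_stepKernelBounds (p := p) (r₀ := r₀) (A := A) hd hLodd hL hR2 hM hkN hp1 hpR hMord hr₀2 hB hδ₀ hδ₁ hh hh0 hh2 hA𝒫 hA1 D hDs hDL hS hB₀ hc₀ hU hHt hHt' hτ hH hH' hb hC hCΔ hK hK' hΔ hKd hK'd
    hKloc hK'loc hv hκ hκ2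
  have h1' : TayNormLE (P.gauge (k + 1) U) r₀ (W.weight (k + 1) U) _ (((blocks (L ^ k) U).card : ℝ) * κ ^ (blocks (L ^ k) U).card * ((16 * Real.exp (3 / 8) * (2 * hamNorm (fieldWt h (L : ℝ) d k) ((L : ℝ) ^ k) (L ^ (d * k)) (H - H') + pi2BoundConst d (((2 * R + 2 : ℕ) : ℝ) + ((d / 2 + 1 : ℕ) : ℝ)) * (CΔ * A𝒫' * A⁻¹))) * (((1 + 8 * pi2BoundConst d (((2 * R + 2 : ℕ) : ℝ) + ((d / 2 + 1 : ℕ) : ℝ))) * (C * A𝒫' * A⁻¹)) + 256 * Real.exp (1 / 4) * ((A𝒫' + 4) * b ^ 2 + 2 * b * (pi2BoundConst d (((2 * R + 2 : ℕ) : ℝ) + ((d / 2 + 1 : ℕ) : ℝ)) * (C * A𝒫' * A⁻¹)) + (pi2BoundConst d (((2 * R + 2 : ℕ) : ℝ) + ((d / 2 + 1 : ℕ) : ℝ)) * (C * A𝒫' * A⁻¹)) ^ 2)) + 16 * Real.exp (3 / 8) * (2 * b + pi2BoundConst d (((2 * R + 2 : ℕ) : ℝ) + ((d / 2 + 1 :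 ℕ) : ℝ)) * (C * A𝒫' * A⁻¹)) * ((1 + 8 * pi2BoundConst d (((2 * R + 2 : ℕ) : ℝ) + ((d / 2 + 1 : ℕ) : ℝ))) * (CΔ * A𝒫' * A⁻¹)) + (512 * Real.exp (1 / 4) * (A𝒫' + 4) * (b + b) * hamNorm (fieldWt h (L : ℝ) d k) ((L : ℝ) ^ k) (L ^ (d * k)) (H - H') + 512 * Real.exp (1 / 4) * (hamNorm (fieldWt h (L : ℝ) d k) ((L : ℝ) ^ k) (L ^ (d * k)) (H - H') * (pi2BoundConst d (((2 * R + 2 : ℕ) : ℝ) + ((d / 2 + 1 : ℕ) : ℝ)) * (C * A𝒫' * A⁻¹)) + b * (pi2BoundConst d (((2 * R + 2 : ℕ) : ℝ) + ((d / 2 + 1 : ℕ) : ℝ)) * (CΔ * A𝒫' * A⁻¹))) + 256 * Real.exp (1 / 4) * (pi2BoundConst d (((2 * R + 2 : ℕ) : ℝ) + ((d / 2 + 1 : ℕ) : ℝ)) * (C * A𝒫' * A⁻¹) + pi2BoundConst d (((2 * R + 2 : ℕ) : ℝ) + ((d / 2 + 1 : ℕ) : ℝ)) * (CΔ * A𝒫'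 * A⁻¹)) * (pi2BoundConst d (((2 * R + 2 : ℕ) : ℝ) + ((d / 2 + 1 : ℕ) : ℝ)) * (CΔ * A𝒫' * A⁻¹))))) :=
    h1.mono
    (by
      gcongr) (fun φ => (W.weight_pos (k + 1) U φ).le)
  have hLd0 : (0 : ℝ) ≤ ((L ^ d : ℕ) : ℝ) := Nat.cast_nonneg _
  have hS1_0 : 0 ≤ ((L ^ d : ℕ) : ℝ) * κ ^ (L ^ d) * ((16 * Real.exp (3 / 8) * (2 * hamNorm (fieldWt h (L : ℝ) d k) ((L : ℝ) ^ k) (L ^ (d * k)) (H - H') + pi2BoundConst d (((2 * R + 2 : ℕ) : ℝ) + ((d / 2 + 1 : ℕ) : ℝ)) * (CΔ * A𝒫' * A⁻¹))) * (((1 + 8 * pi2BoundConst d (((2 * R + 2 : ℕ) : ℝ) + ((d / 2 + 1 : ℕ) : ℝ))) * (C * A𝒫' * A⁻¹)) + 256 * Real.exp (1 / 4) * ((A𝒫' + 4) * b ^ 2 + 2 * b * (pi2BoundConst d (((2 * R + 2 : ℕ) : ℝ) + ((d / 2 + 1 : ℕ) : ℝ)) * (C * A𝒫' * A⁻¹))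 + (pi2BoundConst d (((2 * R + 2 : ℕ) : ℝ) + ((d / 2 + 1 : ℕ) : ℝ)) * (C * A𝒫' * A⁻¹)) ^ 2)) + 16 * Real.exp (3 / 8) * (2 * b + pi2BoundConst d (((2 * R + 2 : ℕ) : ℝ) + ((d / 2 + 1 : ℕ) : ℝ)) * (C * A𝒫' * A⁻¹)) * ((1 + 8 * pi2BoundConst d (((2 * R + 2 : ℕ) : ℝ) + ((d / 2 + 1 : ℕ) : ℝ))) * (CΔ * A𝒫' * A⁻¹)) + (512 * Real.exp (1 / 4) * (A𝒫' + 4) * (b + b) * hamNorm (fieldWt h (L : ℝ) d k) ((L : ℝ) ^ k) (L ^ (d * k)) (H - H') + 512 * Real.exp (1 / 4) * (hamNorm (fieldWt h (L : ℝ) d k) ((L : ℝ) ^ k) (L ^ (d * k)) (H - H') * (pi2BoundConst d (((2 * R + 2 : ℕ) : ℝ) + ((d / 2 + 1 : ℕ) : ℝ)) * (C * A𝒫' * A⁻¹)) + b * (pi2BoundConst d (((2 * R + 2 : ℕ) : ℝ) + ((d / 2 + 1 : ℕ) : ℝ)) * (CΔ * A𝒫' * A⁻¹))) + 256 * Real.exp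 (1 / 4) * (pi2BoundConst d (((2 * R + 2 : ℕ) : ℝ) + ((d / 2 + 1 : ℕ) : ℝ)) * (C * A𝒫' * A⁻¹) + pi2BoundConst d (((2 * R + 2 : ℕ) : ℝ) + ((d / 2 + 1 : ℕ) : ℝ)) * (CΔ * A𝒫' * A⁻¹)) * (pi2BoundConst d (((2 * R + 2 : ℕ) : ℝ) + ((d / 2 + 1 : ℕ) : ℝ)) * (CΔ * A𝒫' * A⁻¹)))) :=
    mul_nonneg (mul_nonneg hLd0 (pow_nonneg hκ0 _)) (add_nonneg (add_nonneg (mul_nonneg hDP0 hg0)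
      (mul_nonneg (mul_nonneg he38 hτ0) hρ1_0)) hρΦ0)
  by_cases hne : (blockPartIndex D U).Nonempty
  · obtain ⟨B, hB'⟩ := hne
    have hcl := (mem_filter.1 hB').2
    have hBb := (mem_filter.1 hB').1
    rw [hDs] at hBb
    obtain ⟨x, -, rfl⟩ := mem_blocks.1 hBb
    rw [hDs, hDL, closure_blockOf_mul hsodd hLodd x] at hcl
    have hcard1 : (blocks (L * L ^ k) U).card = 1 := by rw [← hcl, blocks_blockOf, card_singleton]
    have hnb : numBlocks (P.L ^ (k + 1)) U = 1 := by
      show numBlocks (L ^ (k + 1)) U = 1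
      rw [← card_blocks_eq_numBlocks, pow_succ', hcard1]
    have haF : A * P.aFactor (k + 1) U = 1 := by
      show A * (A ^ numBlocks (P.L ^ (k + 1)) U)⁻¹ = 1
      rw [hnb, pow_one, mul_inv_cancel₀ hA0.ne']
    have hMeq : M = L * L ^ k * L ^ (N - k - 1) := by
      rw [hM, ← pow_succ', ← pow_add]; congr 1; omega
    have hU' : IsPolymer (L * L ^ k) U := by rw [← pow_succ']; exact hU
    have hm0 : (blocks (L ^ k) U).card = L ^ d := by
      rw [TorusPolymer.card_blocks_eq_mul hMeq hsodd hLodd hLodd.pow hU', hcard1, mul_one]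
    rw [hm0] at h1'
    rw [haF, mul_one]
    exact h1'
  · rw [not_nonempty_iff_eq_empty] at hne
    intro φ
    have hF : (fun φ => (∑ B ∈ blockPartIndex D U,
        ((bprod (L ^ k) (fun B' => expNegH (nextH D H K) B' φ) (U \ B) *
              bprod (L ^ k) (fun B' => expNegH (-(nextH D H K)) B' φ) (B \ U) - 1) * blockTerm D K B φ +
          bprod (L ^ k) (fun B' => expNegH (nextH D H K) B' φ) (U \ B) *
              bprod (L ^ k) (fun B' => expNegH (-(nextH D H K)) B' φ) (B \ U) *
            (fluctDefect D.𝒞 H B φ +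
              (expNegH (stepOpA (gradCov D.𝒞) H) B φ - 1) * (1 - Complex.exp (-(eval (opB D K) B φ))) -
              (Complex.exp (-(eval (opB D K) B φ)) - 1 + eval (opB D K) B φ)) +
          bprod (L ^ k) (fun B' => expNegH (nextH D H K) B' φ) (U \ B) *
              bprod (L ^ k) (fun B' => expNegH (-(nextH D H K)) B' φ) (B \ U) *
            fluct D.𝒞 (fun ψ => ∑ Y ∈ ((polys (L ^ k) B).erase B).erase ∅,
              bprod (L ^ k) (fun B' => expNegH H B' ψ - 1) (B \ Y) * K Y ψ) φ)) -
        (∑ B ∈ blockPartIndex D U,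
        ((bprod (L ^ k) (fun B' => expNegH (nextH D H' K') B' φ) (U \ B) *
              bprod (L ^ k) (fun B' => expNegH (-(nextH D H' K')) B' φ) (B \ U) - 1) * blockTerm D K' B φ +
          bprod (L ^ k) (fun B' => expNegH (nextH D H' K') B' φ) (U \ B) *
              bprod (L ^ k) (fun B' => expNegH (-(nextH D H' K')) B' φ) (B \ U) *
            (fluctDefect D.𝒞 H' B φ +
              (expNegH (stepOpA (gradCov D.𝒞) H') B φ - 1) * (1 - Complex.exp (-(eval (opB D K') B φ))) -
              (Complex.exp (-(eval (opB D K') B φ)) - 1 + eval (opB D K') B φ)) +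
          bprod (L ^ k) (fun B' => expNegH (nextH D H' K') B' φ) (U \ B) *
              bprod (L ^ k) (fun B' => expNegH (-(nextH D H' K')) B' φ) (B \ U) *
            fluct D.𝒞 (fun ψ => ∑ Y ∈ ((polys (L ^ k) B).erase B).erase ∅,
              bprod (L ^ k) (fun B' => expNegH H' B' ψ - 1) (B \ Y) * K' Y ψ) φ))) = fun _ => (0 : ℂ) := by
      funext ψ; rw [hne, sum_empty, sum_empty, sub_zero]
    rw [hF, tayNorm_const, norm_zero]
    exact mul_nonneg (mul_nonneg hS1_0 (mul_nonneg hA0.le (WeakNormLE.aFactor_pos hA0 (k + 1) U).le))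
      (W.weight_pos (k + 1) U φ).le

set_option maxHeartbeats 400000 in

/-- **`S_k` is Lipschitz on the small ball (raw constant)** (module docstring): torus data at scale `k`
(`d ≥ 3`, `L` odd, `L ≥ 2^{d+3}+16R`, `R ≥ 2`, `M = L^N`, `k+1 ≤ N`, `⌊d/2⌋+2 ≤ p`, `p + d ≤ M_ord ≤ R`, `r₀ ≥ 3`,
kernel regularity with `h² ≥ secondDiffConst`, `h² ≥ h₀²`, `1 ≤ A`, `0 ≤ A_𝒫 ≤ A`, `2^{L^d}A_𝒫A^{−(1−1/η)} ≤ 1`),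
`U` a connected `(k+1)`-polymer, `‖H‖,‖H'‖ ≤ b ≤ 1/64`, admissible `K, K'` (factorising, `K(∅)=1`, local,
`C^{r₀}`, translation invariant) with `‖K‖,‖K'‖ ≤ C`, `‖K−K'‖ ≤ C_Δ`, `C_{8.7}CA_𝒫A^{−1} ≤ 1/64`.
[cite: AdamsBuchholzKoteckyMuller2019, Theorem 6.8 / Lemma 9.6 / Ch. 12 (12.4)] -/
theorem tayNormLE_nextKStep_sub_abkm_raw_of_stepKernelBounds {L N Mord R n p r₀ : ℕ} {θbar lam μ δ₁ δ₀ A𝒫 A𝒫' C₂ h A : ℝ}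
    {𝒞 : ℕ → (Fin d → ZMod M) → ℝ} (hd : 3 ≤ d) (hLodd : Odd L) (hL : 2 ^ (d + 3) + 16 * R ≤ L)
    (hR2 : 2 ≤ R) (hM : M = L ^ N) {k : ℕ} (hkN : k + 1 ≤ N)
    (hp : d / 2 + 2 ≤ p) (hpM : p + d ≤ Mord) (hMR : Mord ≤ R) (hr₀ : 3 ≤ r₀)
   
    (hB : AbkmWeightBounds L N Mord R n θbar lam μ δ₁ δ₀ A𝒫 𝒞
      (abkmWeightData L N Mord R θbar (schedDelta δ₀ δ₁ N) 𝒞))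
    (hδ₀ : 0 < δ₀) (hδ₁ : 0 < δ₁) (hh : 0 < h) (hh0 : hZeroSq d R δ₀ δ₁ ≤ h ^ 2)
   
    (hh2 : C₂ ≤ h ^ 2) (hA𝒫 : 0 ≤ A𝒫') (hA1 : 1 ≤ A)
    (hA𝒫A : A𝒫' ≤ A)
    (hsmall : (2 : ℝ) ^ (L ^ d) * (A𝒫' * A ^ (-(1 - (1 + 1 / ((2 * (2 ^ d + 1) + 6 : ℝ) ^ d))⁻¹) : ℝ)) ≤ 1)
    (D : StepData d M) (hDs : D.s = L ^ k) (hDL : D.L = L) (hS : StepKernelBounds (abkmWeightData L N Mord R θbar (schedDelta δ₀ δ₁ N) 𝒞) L k A𝒫' C₂ D.𝒞)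
    {x₀ : Fin d → ZMod M} (hB₀ : D.B₀ = blockOf (L ^ k) x₀) (hc₀ : D.c₀ = boxCorner (L ^ k) (starRad R L d k) x₀)
    {U : Finset (Fin d → ZMod M)} (hU : IsPolymer (L ^ (k + 1)) U)
    (hUc : IsConn U)
    {H H' : RelevantHamiltonian ℂ d} {b : ℝ}
    (hH : hamNorm (fieldWt h (L : ℝ) d k) ((L : ℝ) ^ k) (L ^ (d * k)) H ≤ b)
    (hH' : hamNorm (fieldWt h (L : ℝ) d k) ((L : ℝ) ^ k) (L ^ (d * k)) H' ≤ b) (hb : b ≤ 1 / 64)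
    {K K' : Finset (Fin d → ZMod M) → ((Fin d → ZMod M) → ℝ) → ℂ} {C CΔ : ℝ} (hC : 0 ≤ C) (hCΔ : 0 ≤ CΔ)
    (hK : WeakNormLE (abkmNormParams L N Mord R p r₀ h θbar A (schedDelta δ₀ δ₁ N) 𝒞) k K C)
    (hK' : WeakNormLE (abkmNormParams L N Mord R p r₀ h θbar A (schedDelta δ₀ δ₁ N) 𝒞) k K' C)
    (hΔ : WeakNormLE (abkmNormParams L N Mord R p r₀ h θbar A (schedDelta δ₀ δ₁ N) 𝒞) k (K - K') CΔ)
    (hKfac : Factorises (L ^ k) K) (hK0 : ∀ φ, K ∅ φ = 1) (hK'fac : Factorises (L ^ k) K') (hK'0 : ∀ φ, K' ∅ φ = 1)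
    (hKd : ∀ Y, ContDiff ℝ r₀ (K Y)) (hK'd : ∀ Y, ContDiff ℝ r₀ (K' Y))
    (hKloc : ∀ Y, IsPolymer (L ^ k) Y → IsConn Y → IsGaugeLocal ((abkmNormParams L N Mord R p r₀ h θbar A (schedDelta δ₀ δ₁ N) 𝒞).gauge k Y) (K Y))
    (hK'loc : ∀ Y, IsPolymer (L ^ k) Y → IsConn Y → IsGaugeLocal ((abkmNormParams L N Mord R p r₀ h θbar A (schedDelta δ₀ δ₁ N) 𝒞).gauge k Y) (K' Y))
    (hKt : TransInv (L ^ k) K) (hK't : TransInv (L ^ k) K')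
    (hv : pi2BoundConst d (((2 * R + 2 : ℕ) : ℝ) + ((d / 2 + 1 : ℕ) : ℝ)) * (C * A𝒫' * A⁻¹) ≤ 1 / 64)
    {ω : ℝ}
    (hω1 : 8 * Real.exp (1 / 4) * (2 * b + pi2BoundConst d (((2 * R + 2 : ℕ) : ℝ) + ((d / 2 + 1 : ℕ) : ℝ)) * (C * A𝒫' * A⁻¹)) + 16 * Real.exp (3 / 8) * (2 * hamNorm (fieldWt h (L : ℝ) d k) ((L : ℝ) ^ k) (L ^ (d * k)) (H - H') + pi2BoundConst d (((2 * R + 2 : ℕ) : ℝ) + ((d / 2 + 1 : ℕ) : ℝ)) * (CΔ * A𝒫' * A⁻¹)) ≤ ω)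
    (hω2 : 8 * Real.exp (1 / 4) * b + 16 * Real.exp (3 / 8) * hamNorm (fieldWt h (L : ℝ) d k) ((L : ℝ) ^ k) (L ^ (d * k)) (H - H') ≤ ω)
    (hω3 : C + CΔ ≤ ω) (hωA : ω * A ^ 2 ≤ 1)
    {κ : ℝ}
    (hκ1 : 1 + Real.exp (1 / 4) + 16 * Real.exp (3 / 8) * (2 * hamNorm (fieldWt h (L : ℝ) d k) ((L : ℝ) ^ k) (L ^ (d * k)) (H - H') + pi2BoundConst d (((2 * R + 2 : ℕ) : ℝ) + ((d / 2 + 1 : ℕ) : ℝ)) * (CΔ * A𝒫' * A⁻¹)) ≤ κ)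
    (hκ2 : 1 + Real.exp (1 / 4) + 16 * Real.exp (3 / 8) * (2 * b + pi2BoundConst d (((2 * R + 2 : ℕ) : ℝ) + ((d / 2 + 1 : ℕ) : ℝ)) * (C * A𝒫' * A⁻¹)) ≤ κ) :
    TayNormLE ((abkmNormParams L N Mord R p r₀ h θbar A (schedDelta δ₀ δ₁ N) 𝒞).gauge (k + 1) U) r₀ ((abkmWeightData L N Mord R θbar (schedDelta δ₀ δ₁ N) 𝒞).weight (k + 1) U)
      (fun φ => nextKStep D H K U φ - nextKStep D H' K' U φ)
      (CΔ * ((L : ℝ) ^ d * (A𝒫' * abkmContrConst d L R) + largePartEps d L A A𝒫' (1 + 1 / ((2 * (2 ^ d + 1) + 6 : ℝ) ^ d)) + largePartEps d L A A𝒫' (1 + 1 / ((2 * (2 ^ d + 1) + 6 : ℝ) ^ d))) * (abkmNormParams L N Mord R p r₀ h θbar A (schedDelta δ₀ δ₁ N) 𝒞).aFactor (k + 1) U +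
        ((L ^ d : ℕ) : ℝ) * κ ^ (L ^ d) * ((16 * Real.exp (3 / 8) * (2 * hamNorm (fieldWt h (L : ℝ) d k) ((L : ℝ) ^ k) (L ^ (d * k)) (H - H') + pi2BoundConst d (((2 * R + 2 : ℕ) : ℝ) + ((d / 2 + 1 : ℕ) : ℝ)) * (CΔ * A𝒫' * A⁻¹))) * (((1 + 8 * pi2BoundConst d (((2 * R + 2 : ℕ) : ℝ) + ((d / 2 + 1 : ℕ) : ℝ))) * (C * A𝒫' * A⁻¹)) + 256 * Real.exp (1 / 4) * ((A𝒫' + 4) * b ^ 2 + 2 * b * (pi2BoundConst d (((2 * R + 2 : ℕ) : ℝ) + ((d / 2 + 1 : ℕ) : ℝ)) * (C * A𝒫' * A⁻¹)) + (pi2BoundConst d (((2 * R + 2 : ℕ) : ℝ) + ((d / 2 + 1 : ℕ) : ℝ)) * (C * A𝒫' * A⁻¹)) ^ 2)) + 16 * Real.exp (3 / 8) * (2 * b + pi2BoundConst d (((2 * R + 2 : ℕ) : ℝ) + ((d / 2 + 1 : ℕ) : ℝ)) * (C * A𝒫' * A⁻¹)) * ((1 + 8 * pi2BoundConst d (((2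 * R + 2 : ℕ) : ℝ) + ((d / 2 + 1 : ℕ) : ℝ))) * (CΔ * A𝒫' * A⁻¹)) + (512 * Real.exp (1 / 4) * (A𝒫' + 4) * (b + b) * hamNorm (fieldWt h (L : ℝ) d k) ((L : ℝ) ^ k) (L ^ (d * k)) (H - H') + 512 * Real.exp (1 / 4) * (hamNorm (fieldWt h (L : ℝ) d k) ((L : ℝ) ^ k) (L ^ (d * k)) (H - H') * (pi2BoundConst d (((2 * R + 2 : ℕ) : ℝ) + ((d / 2 + 1 : ℕ) : ℝ)) * (C * A𝒫' * A⁻¹)) + b * (pi2BoundConst d (((2 * R + 2 : ℕ) : ℝ) + ((d / 2 + 1 : ℕ) : ℝ)) * (CΔ * A𝒫' * A⁻¹))) + 256 * Real.exp (1 / 4) * (pi2BoundConst d (((2 * R + 2 : ℕ) : ℝ) + ((d / 2 + 1 : ℕ) : ℝ)) * (C * A𝒫' * A⁻¹) + pi2BoundConst d (((2 * R + 2 : ℕ) : ℝ) + ((d / 2 + 1 : ℕ) : ℝ)) * (CΔ * A𝒫' * A⁻¹)) * (pi2BoundConst d (((2 * R + 2 : ℕ) : ℝ) + ((d / 2 +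 1 : ℕ) : ℝ)) * (CΔ * A𝒫' * A⁻¹)))) * (A * (abkmNormParams L N Mord R p r₀ h θbar A (schedDelta δ₀ δ₁ N) 𝒞).aFactor (k + 1) U) +
        (κ ^ (blocks (L ^ k) U).card * ((3 * (16 * Real.exp (3 / 8) * (2 * hamNorm (fieldWt h (L : ℝ) d k) ((L : ℝ) ^ k) (L ^ (d * k)) (H - H') + pi2BoundConst d (((2 * R + 2 : ℕ) : ℝ) + ((d / 2 + 1 : ℕ) : ℝ)) * (CΔ * A𝒫' * A⁻¹))) + 16 * Real.exp (3 / 8) * hamNorm (fieldWt h (L : ℝ) d k) ((L : ℝ) ^ k) (L ^ (d * k)) (H - H') + CΔ) * (ω * A ^ 4)) * (((2 * (2 * κ * max 1 A𝒫')) ^ ((2 ^ (d + 1) + 2) ^ d * L ^ d) * (4 : ℝ) ^ ((2 ^ (d + 1) + 2) ^ d * L ^ d)) ^ (blocks (L * L ^ k) U).card * A ^ (-((1 + 1 / ((2 * (2 ^ d + 1) + 6 : ℝ) ^ d)) * (blocks (L * L ^ k) U).card) : ℝ)) +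
          κ ^ (blocks (L ^ k) U).card * (2 * (16 * Real.exp (3 / 8) * (2 * hamNorm (fieldWt h (L : ℝ) d k) ((L : ℝ) ^ k) (L ^ (d * k)) (H - H') + pi2BoundConst d (((2 * R + 2 : ℕ) : ℝ) + ((d / 2 + 1 : ℕ) : ℝ)) * (CΔ * A𝒫' * A⁻¹))) + CΔ) * (((2 * κ * max 1 A𝒫') ^ ((2 ^ (d + 1) + 2) ^ d * L ^ d) * (2 : ℝ) ^ ((2 ^ (d + 1) + 2) ^ d * L ^ d)) ^ (blocks (L * L ^ k) U).card * A ^ (-((1 + 1 / ((2 * (2 ^ d + 1) + 6 : ℝ) ^ d)) * (blocks (L * L ^ k) U).card) : ℝ))) +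
        κ ^ (blocks (L ^ k) U).card * ((3 * (16 * Real.exp (3 / 8) * (2 * hamNorm (fieldWt h (L : ℝ) d k) ((L : ℝ) ^ k) (L ^ (d * k)) (H - H') + pi2BoundConst d (((2 * R + 2 : ℕ) : ℝ) + ((d / 2 + 1 : ℕ) : ℝ)) * (CΔ * A𝒫' * A⁻¹))) + 16 * Real.exp (3 / 8) * hamNorm (fieldWt h (L : ℝ) d k) ((L : ℝ) ^ k) (L ^ (d * k)) (H - H') + CΔ) * (ω * A ^ 4)) * (((2 * (2 * κ * max 1 A𝒫')) ^ ((2 ^ (d + 1) + 2) ^ d * L ^ d) * (4 : ℝ) ^ ((2 ^ (d + 1) + 2) ^ d * L ^ d)) ^ (blocks (L * L ^ k) U).card * A ^ (-((1 + 1 / ((2 * (2 ^ d + 1) + 6 : ℝ) ^ d)) * (blocks (L * L ^ k) U).card) : ℝ)) +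
        κ ^ (blocks (L ^ k) U).card * ((3 * (16 * Real.exp (3 / 8) * (2 * hamNorm (fieldWt h (L : ℝ) d k) ((L : ℝ) ^ k) (L ^ (d * k)) (H - H') + pi2BoundConst d (((2 * R + 2 : ℕ) : ℝ) + ((d / 2 + 1 : ℕ) : ℝ)) * (CΔ * A𝒫' * A⁻¹))) + 16 * Real.exp (3 / 8) * hamNorm (fieldWt h (L : ℝ) d k) ((L : ℝ) ^ k) (L ^ (d * k)) (H - H') + CΔ) * (ω * A ^ 4)) * (((2 * (2 * κ * max 1 A𝒫')) ^ ((2 ^ (d + 1) + 2) ^ d * L ^ d) * (4 : ℝ) ^ ((2 ^ (d + 1) + 2) ^ d * L ^ d)) ^ (blocks (L * L ^ k) U).card * A ^ (-((1 + 1 / ((2 * (2 ^ d + 1) + 6 : ℝ) ^ d)) * (blocks (L * L ^ k) U).card) : ℝ))) := by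
  set P := abkmNormParams L N Mord R p r₀ h θbar A (schedDelta δ₀ δ₁ N) 𝒞 with hP
  set W := abkmWeightData L N Mord R θbar (schedDelta δ₀ δ₁ N) 𝒞 with hW
  have hd2 : 2 ≤ d := by omega
  have hp1 : d / 2 + 1 ≤ p := by omega
  have hpR : p ≤ R := by omega
  have hMord : d / 2 + 1 ≤ Mord := by omega
  have hr₀2 : 2 ≤ r₀ := by omega
  have hL0 : (0 : ℝ) < L := by exact_mod_cast hLodd.pos
  have hA0 : 0 < A := by linarith
  have hk1 : k + 1 ≤ N + 1 := by omega
  have hUne : U.Nonempty := hUc.1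
  have hH8 : hamNorm (fieldWt h (L : ℝ) d k) ((L : ℝ) ^ k) (L ^ (d * k)) H ≤ 1 / 8 := by linarith [hH, hb]
  have hH'8 : hamNorm (fieldWt h (L : ℝ) d k) ((L : ℝ) ^ k) (L ^ (d * k)) H' ≤ 1 / 8 := by linarith [hH', hb]
  -- the five pieces
  have h0 := tayNormLE_blockPart_sub_abkm_of_stepKernelBounds hd hLodd hL hM hkN hp hpM hMR hr₀ hB hδ₀ hδ₁ hh hh0 hA𝒫 hA1 hA𝒫A
    hsmall D hDs hDL hS hB₀ hc₀ hC hC hCΔ hK hK' hΔ hKt hK't hKd hK'd hKloc hK'loc hU hUc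
  have h1 := tayNormLE_remainderOne_sub_abkm_block_of_stepKernelBounds hd hLodd hL hR2 hM hkN hp1 hpR hMord hr₀2 hB hδ₀ hδ₁ hh
    hh0 hh2 hA𝒫 hA1 D hDs hDL hS hB₀ hc₀ hU hH hH' hb hC hCΔ hK hK' hΔ hKd hK'd hKloc hK'loc hv hκ1 hκ2
  have h2 := tayNormLE_remainderTwoLarge_sub_abkm_final_of_stepKernelBounds hd hLodd hL hR2 hM hkN hp1 hpR hMord hr₀2 hB hδ₀
    hδ₁ hh hh0 hh2 hA𝒫 hA1 D hS hB₀ hc₀ hU hH hH' hb hC hCΔ hK hK' hΔ hKfac hK0 hK'fac hK'0 hKd hK'd hKloc hK'loc hv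
    hω1 hω2 hω3 hωA hκ1
  have h3 := tayNormLE_remainderThree_sub_abkm_final_of_stepKernelBounds hd hLodd hL hR2 hM hkN hp1 hpR hMord hr₀2 hB hδ₀
    hδ₁ hh hh0 hh2 hA𝒫 hA1 D hS hB₀ hc₀ hU hUne hH hH' hb hC hCΔ hK hK' hΔ hKfac hK0 hK'fac hK'0 hKd hK'd hKloc
    hK'loc hv hω1 hω2 hω3 hωA hκ1
  have h4 := tayNormLE_remainderFour_sub_abkm_final_of_stepKernelBounds hd hLodd hL hR2 hM hkN hp1 hpR hMord hr₀2 hB hδ₀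
    hδ₁ hh hh0 hh2 hA𝒫 hA1 D hS hB₀ hc₀ hU hH hH' hb hC hCΔ hK hK' hΔ hKfac hK0 hK'fac hK'0 hKd hK'd hKloc hK'loc hv
    hω1 hω2 hω3 hωA hκ1
  -- smoothness of the five functionals
  have hUk : ∀ X ∈ ((polys (L ^ k) univ).filter (fun X => reblock (L ^ k) (L * L ^ k) X = U)), IsPolymer (L ^ k) X :=
    fun X hX => (mem_polys.1 (mem_filter.1 hX).1).2
  have hF0d : ContDiff ℝ r₀ (fun φ => blockPart D K U φ - blockPart D K' U φ) :=
    (contDiff_blockPart_abkm_of_stepKernelBounds hB hLodd hM hA0 D hDs hS hC hK hKd hKloc U).sub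
      (contDiff_blockPart_abkm_of_stepKernelBounds hB hLodd hM hA0 D hDs hS hC hK' hK'd hK'loc U)
  have hblk : ∀ B ∈ blockPartIndex D U, ∃ y, B = blockOf (L ^ k) y := fun B hB' => by
    have hBb := blockPartIndex_subset_blocks D U hB'
    rw [hDs] at hBb
    obtain ⟨y, -, rfl⟩ := mem_blocks.1 hBb
    exact ⟨y, rfl⟩
  have hF1d : ContDiff ℝ r₀ (fun φ => (∑ B ∈ blockPartIndex D U,
        ((bprod (L ^ k) (fun B' => expNegH (nextH D H K) B' φ) (U \ B) *
              bprod (L ^ k) (fun B' => expNegH (-(nextH D H K)) B' φ) (B \ U) - 1) * blockTerm D K B φ +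
          bprod (L ^ k) (fun B' => expNegH (nextH D H K) B' φ) (U \ B) *
              bprod (L ^ k) (fun B' => expNegH (-(nextH D H K)) B' φ) (B \ U) *
            (fluctDefect D.𝒞 H B φ +
              (expNegH (stepOpA (gradCov D.𝒞) H) B φ - 1) * (1 - Complex.exp (-(eval (opB D K) B φ))) -
              (Complex.exp (-(eval (opB D K) B φ)) - 1 + eval (opB D K) B φ)) +
          bprod (L ^ k) (fun B' => expNegH (nextH D H K) B' φ) (U \ B) *
              bprod (L ^ k) (fun B' => expNegH (-(nextH D H K)) B' φ) (B \ U) *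
            fluct D.𝒞 (fun ψ => ∑ Y ∈ ((polys (L ^ k) B).erase B).erase ∅,
              bprod (L ^ k) (fun B' => expNegH H B' ψ - 1) (B \ Y) * K Y ψ) φ)) -
        (∑ B ∈ blockPartIndex D U,
        ((bprod (L ^ k) (fun B' => expNegH (nextH D H' K') B' φ) (U \ B) *
              bprod (L ^ k) (fun B' => expNegH (-(nextH D H' K')) B' φ) (B \ U) - 1) * blockTerm D K' B φ +
          bprod (L ^ k) (fun B' => expNegH (nextH D H' K') B' φ) (U \ B) *
              bprod (L ^ k) (fun B' => expNegH (-(nextH D H' K')) B' φ) (B \ U) *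
            (fluctDefect D.𝒞 H' B φ +
              (expNegH (stepOpA (gradCov D.𝒞) H') B φ - 1) * (1 - Complex.exp (-(eval (opB D K') B φ))) -
              (Complex.exp (-(eval (opB D K') B φ)) - 1 + eval (opB D K') B φ)) +
          bprod (L ^ k) (fun B' => expNegH (nextH D H' K') B' φ) (U \ B) *
              bprod (L ^ k) (fun B' => expNegH (-(nextH D H' K')) B' φ) (B \ U) *
            fluct D.𝒞 (fun ψ => ∑ Y ∈ ((polys (L ^ k) B).erase B).erase ∅,
              bprod (L ^ k) (fun B' => expNegH H' B' ψ - 1) (B \ Y) * K' Y ψ) φ))) := by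
    refine (ContDiff.sum fun B hB' => ?_).sub (ContDiff.sum fun B hB' => ?_)
    · obtain ⟨y, rfl⟩ := hblk B hB'
      exact contDiff_blockSummand_abkm_of_stepKernelBounds (p := p) (r₀ := r₀) (A := A) hd2 hB hLodd hM hkN hδ₀ hδ₁ hh hh0 hMord hp1
        hA0 D hS y (nextH D H K) hH8 hC hK hKd hKloc U
    · obtain ⟨y, rfl⟩ := hblk B hB'
      exact contDiff_blockSummand_abkm_of_stepKernelBounds (p := p) (r₀ := r₀) (A := A) hd2 hB hLodd hM hkN hδ₀ hδ₁ hh hh0 hMord hp1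
        hA0 D hS y (nextH D H' K') hH'8 hC hK' hK'd hK'loc U
  have hF2d : ContDiff ℝ r₀ (fun φ => ∑ X ∈ largePartIndex (L ^ k) L U,
        (bprod (L ^ k) (fun B => expNegH (nextH D H K) B φ) (U \ X) * bprod (L ^ k) (fun B => expNegH (-(nextH D H K)) B φ) (X \ U) *
            (fluct D.𝒞 (polyP2 (L ^ k) H K X) φ + bprod (L ^ k) (fun B => 1 - expNegH (nextH D H K) B φ) X) -
          bprod (L ^ k) (fun B => expNegH (nextH D H' K') B φ) (U \ X) * bprod (L ^ k) (fun B => expNegH (-(nextH D H' K')) B φ) (X \ U) *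
            (fluct D.𝒞 (polyP2 (L ^ k) H' K' X) φ + bprod (L ^ k) (fun B => 1 - expNegH (nextH D H' K') B φ) X))) := by
    refine ContDiff.sum fun X hX => ?_
    obtain ⟨hXp, -, -, -⟩ := mem_largePartIndex.1 hX
    exact (contDiff_reblockTop_abkm_of_stepKernelBounds hd2 hLodd hM hkN hS hp1 hMord hB hδ₀ hδ₁ hh hh0 hA0 hXp (nextH D H K) hH8 hC
      hK hKfac hK0 hKd hKloc U).sub
      (contDiff_reblockTop_abkm_of_stepKernelBounds hd2 hLodd hM hkN hS hp1 hMord hB hδ₀ hδ₁ hh hh0 hA0 hXp (nextH D H' K') hH'8 hC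
        hK' hK'fac hK'0 hK'd hK'loc U)
  have hF3d : ContDiff ℝ r₀ (fun φ => ∑ X ∈ ((polys (L ^ k) univ).filter (fun X => reblock (L ^ k) (L * L ^ k) X = U)).filter
          (fun X => ¬ IsConn X),
        (bprod (L ^ k) (fun B => expNegH (nextH D H K) B φ) (U \ X) * bprod (L ^ k) (fun B => expNegH (-(nextH D H K)) B φ) (X \ U) *
            (fluct D.𝒞 (polyP2 (L ^ k) H K X) φ + bprod (L ^ k) (fun B => 1 - expNegH (nextH D H K) B φ) X) -
          bprod (L ^ k) (fun B => expNegH (nextH D H' K') B φ) (U \ X) * bprod (L ^ k) (fun B => expNegH (-(nextH D H' K')) B φ) (X \ U) *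
            (fluct D.𝒞 (polyP2 (L ^ k) H' K' X) φ + bprod (L ^ k) (fun B => 1 - expNegH (nextH D H' K') B φ) X))) := by
    refine ContDiff.sum fun X hX => ?_
    have hXp := hUk X (mem_filter.1 hX).1
    exact (contDiff_reblockTop_abkm_of_stepKernelBounds hd2 hLodd hM hkN hS hp1 hMord hB hδ₀ hδ₁ hh hh0 hA0 hXp (nextH D H K) hH8 hC
      hK hKfac hK0 hKd hKloc U).sub
      (contDiff_reblockTop_abkm_of_stepKernelBounds hd2 hLodd hM hkN hS hp1 hMord hB hδ₀ hδ₁ hh hh0 hA0 hXp (nextH D H' K') hH'8 hC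
        hK' hK'fac hK'0 hK'd hK'loc U)
  have hF4d : ContDiff ℝ r₀ (fun φ => ∑ X ∈ ((polys (L ^ k) univ).filter (fun X => reblock (L ^ k) (L * L ^ k) X = U)),
        ∑ X₁ ∈ ((polys (L ^ k) X).erase X).erase ∅,
        (bprod (L ^ k) (fun B => expNegH (nextH D H K) B φ) (U \ X) * bprod (L ^ k) (fun B => expNegH (-(nextH D H K)) B φ) (X \ U) *
            (bprod (L ^ k) (fun B => 1 - expNegH (nextH D H K) B φ) X₁ * fluct D.𝒞 (polyP2 (L ^ k) H K (X \ X₁)) φ) -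
          bprod (L ^ k) (fun B => expNegH (nextH D H' K') B φ) (U \ X) * bprod (L ^ k) (fun B => expNegH (-(nextH D H' K')) B φ) (X \ U) *
            (bprod (L ^ k) (fun B => 1 - expNegH (nextH D H' K') B φ) X₁ * fluct D.𝒞 (polyP2 (L ^ k) H' K' (X \ X₁)) φ))) := by
    refine ContDiff.sum fun X hX => ContDiff.sum fun X₁ hX₁ => ?_
    have hXp := hUk X hX
    have hX₁p : X₁ ∈ polys (L ^ k) X := mem_of_mem_erase (mem_of_mem_erase hX₁)
    exact (contDiff_reblockSub_abkm_of_stepKernelBounds hd2 hLodd hM hkN hS hp1 hMord hB hδ₀ hδ₁ hh hh0 hA0 hXp hX₁p (nextH D H K) hH8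
      hC hK hKfac hK0 hKd hKloc U).sub
      (contDiff_reblockSub_abkm_of_stepKernelBounds hd2 hLodd hM hkN hS hp1 hMord hB hδ₀ hδ₁ hh hh0 hA0 hXp hX₁p (nextH D H' K') hH'8
        hC hK' hK'fac hK'0 hK'd hK'loc U)
  have hsum := (((h0.add h1 hF0d hF1d).add h2 (hF0d.add hF1d) hF2d).add h3 ((hF0d.add hF1d).add hF2d) hF3d).add h4
    (((hF0d.add hF1d).add hF2d).add hF3d) hF4d
  -- the decomposition of `S(H,K)(U)` and of `S(H',K')(U)`
  have hdec := nextKStep_eq_blockPart_add_remainders_abkm_of_stepKernelBounds (p := p) (r₀ := r₀) (A := A) hd2 hLodd hL hM hkN hp1 hpR hMord hB hδ₀ hδ₁ hh hh0 hA0 D hDs hDL hS hB₀ hc₀ hH8 hC hK hKfac hK0 hKd hKloc hUne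
  have hdec' := nextKStep_eq_blockPart_add_remainders_abkm_of_stepKernelBounds (p := p) (r₀ := r₀) (A := A) hd2 hLodd hL hM hkN hp1 hpR hMord hB hδ₀ hδ₁ hh hh0 hA0 D hDs hDL hS hB₀ hc₀ hH'8 hC hK' hK'fac hK'0 hK'd hK'loc hUne
  have hfun : (fun φ => nextKStep D H K U φ - nextKStep D H' K' U φ) =
      (fun φ => blockPart D K U φ - blockPart D K' U φ) + (fun φ => (∑ B ∈ blockPartIndex D U,
        ((bprod (L ^ k) (fun B' => expNegH (nextH D H K) B' φ) (U \ B) *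
              bprod (L ^ k) (fun B' => expNegH (-(nextH D H K)) B' φ) (B \ U) - 1) * blockTerm D K B φ +
          bprod (L ^ k) (fun B' => expNegH (nextH D H K) B' φ) (U \ B) *
              bprod (L ^ k) (fun B' => expNegH (-(nextH D H K)) B' φ) (B \ U) *
            (fluctDefect D.𝒞 H B φ +
              (expNegH (stepOpA (gradCov D.𝒞) H) B φ - 1) * (1 - Complex.exp (-(eval (opB D K) B φ))) -
              (Complex.exp (-(eval (opB D K) B φ)) - 1 + eval (opB D K) B φ)) +
          bprod (L ^ k) (fun B' => expNegH (nextH D H K) B' φ) (U \ B) *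
              bprod (L ^ k) (fun B' => expNegH (-(nextH D H K)) B' φ) (B \ U) *
            fluct D.𝒞 (fun ψ => ∑ Y ∈ ((polys (L ^ k) B).erase B).erase ∅,
              bprod (L ^ k) (fun B' => expNegH H B' ψ - 1) (B \ Y) * K Y ψ) φ)) -
        (∑ B ∈ blockPartIndex D U,
        ((bprod (L ^ k) (fun B' => expNegH (nextH D H' K') B' φ) (U \ B) *
              bprod (L ^ k) (fun B' => expNegH (-(nextH D H' K')) B' φ) (B \ U) - 1) * blockTerm D K' B φ +
          bprod (L ^ k) (fun B' => expNegH (nextH D H' K') B' φ) (U \ B) *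
              bprod (L ^ k) (fun B' => expNegH (-(nextH D H' K')) B' φ) (B \ U) *
            (fluctDefect D.𝒞 H' B φ +
              (expNegH (stepOpA (gradCov D.𝒞) H') B φ - 1) * (1 - Complex.exp (-(eval (opB D K') B φ))) -
              (Complex.exp (-(eval (opB D K') B φ)) - 1 + eval (opB D K') B φ)) +
          bprod (L ^ k) (fun B' => expNegH (nextH D H' K') B' φ) (U \ B) *
              bprod (L ^ k) (fun B' => expNegH (-(nextH D H' K')) B' φ) (B \ U) *
            fluct D.𝒞 (fun ψ => ∑ Y ∈ ((polys (L ^ k) B).erase B).erase ∅,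
              bprod (L ^ k) (fun B' => expNegH H' B' ψ - 1) (B \ Y) * K' Y ψ) φ))) + (fun φ => ∑ X ∈ largePartIndex (L ^ k) L U,
        (bprod (L ^ k) (fun B => expNegH (nextH D H K) B φ) (U \ X) * bprod (L ^ k) (fun B => expNegH (-(nextH D H K)) B φ) (X \ U) *
            (fluct D.𝒞 (polyP2 (L ^ k) H K X) φ + bprod (L ^ k) (fun B => 1 - expNegH (nextH D H K) B φ) X) -
          bprod (L ^ k) (fun B => expNegH (nextH D H' K') B φ) (U \ X) * bprod (L ^ k) (fun B => expNegH (-(nextH D H' K')) B φ) (X \ U) *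
            (fluct D.𝒞 (polyP2 (L ^ k) H' K' X) φ + bprod (L ^ k) (fun B => 1 - expNegH (nextH D H' K') B φ) X))) + (fun φ => ∑ X ∈ ((polys (L ^ k) univ).filter (fun X => reblock (L ^ k) (L * L ^ k) X = U)).filter
          (fun X => ¬ IsConn X),
        (bprod (L ^ k) (fun B => expNegH (nextH D H K) B φ) (U \ X) * bprod (L ^ k) (fun B => expNegH (-(nextH D H K)) B φ) (X \ U) *
            (fluct D.𝒞 (polyP2 (L ^ k) H K X) φ + bprod (L ^ k) (fun B => 1 - expNegH (nextH D H K) B φ) X) -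
          bprod (L ^ k) (fun B => expNegH (nextH D H' K') B φ) (U \ X) * bprod (L ^ k) (fun B => expNegH (-(nextH D H' K')) B φ) (X \ U) *
            (fluct D.𝒞 (polyP2 (L ^ k) H' K' X) φ + bprod (L ^ k) (fun B => 1 - expNegH (nextH D H' K') B φ) X))) + (fun φ => ∑ X ∈ ((polys (L ^ k) univ).filter (fun X => reblock (L ^ k) (L * L ^ k) X = U)),
        ∑ X₁ ∈ ((polys (L ^ k) X).erase X).erase ∅,
        (bprod (L ^ k) (fun B => expNegH (nextH D H K) B φ) (U \ X) * bprod (L ^ k) (fun B => expNegH (-(nextH D H K)) B φ) (X \ U) *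
            (bprod (L ^ k) (fun B => 1 - expNegH (nextH D H K) B φ) X₁ * fluct D.𝒞 (polyP2 (L ^ k) H K (X \ X₁)) φ) -
          bprod (L ^ k) (fun B => expNegH (nextH D H' K') B φ) (U \ X) * bprod (L ^ k) (fun B => expNegH (-(nextH D H' K')) B φ) (X \ U) *
            (bprod (L ^ k) (fun B => 1 - expNegH (nextH D H' K') B φ) X₁ * fluct D.𝒞 (polyP2 (L ^ k) H' K' (X \ X₁)) φ))) := by
    funext ψ
    simp only [Pi.add_apply]
    rw [hdec ψ, hdec' ψ]
    simp only [sum_sub_distrib]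
    ring
  rw [hfun]
  exact hsum

/-- **`‖S(H,K) − S(H',K')‖_{k+1}^{(A)} ≤ Θ`** (module docstring): the data of `tayNormLE_nextKStep_sub_abkm_raw_of_stepKernelBounds`
plus the largeness of `A` against the block-product and counting constants,
`κ^{L^d}·c₃ ≤ A^{η−1}` and `κ^{L^d}·c₂ ≤ A^{η−1}`.
[cite: AdamsBuchholzKoteckyMuller2019, Theorem 6.8 / Ch. 12 (12.4)] -/
theorem weakNormLE_nextKStep_sub_abkm_of_stepKernelBounds {L N Mord R n p r₀ : ℕ} {θbar lam μ δ₁ δ₀ A𝒫 A𝒫' C₂ h A : ℝ}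
    {𝒞 : ℕ → (Fin d → ZMod M) → ℝ} (hd : 3 ≤ d) (hLodd : Odd L) (hL : 2 ^ (d + 3) + 16 * R ≤ L)
    (hR2 : 2 ≤ R) (hM : M = L ^ N) {k : ℕ} (hkN : k + 1 ≤ N)
    (hp : d / 2 + 2 ≤ p) (hpM : p + d ≤ Mord) (hMR : Mord ≤ R) (hr₀ : 3 ≤ r₀)
   
    (hB : AbkmWeightBounds L N Mord R n θbar lam μ δ₁ δ₀ A𝒫 𝒞
      (abkmWeightData L N Mord R θbar (schedDelta δ₀ δ₁ N) 𝒞))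
    (hδ₀ : 0 < δ₀) (hδ₁ : 0 < δ₁) (hh : 0 < h) (hh0 : hZeroSq d R δ₀ δ₁ ≤ h ^ 2)
   
    (hh2 : C₂ ≤ h ^ 2) (hA𝒫 : 0 ≤ A𝒫') (hA1 : 1 ≤ A)
    (hA𝒫A : A𝒫' ≤ A)
    (hsmall : (2 : ℝ) ^ (L ^ d) * (A𝒫' * A ^ (-(1 - (1 + 1 / ((2 * (2 ^ d + 1) + 6 : ℝ) ^ d))⁻¹) : ℝ)) ≤ 1)
    (D : StepData d M) (hDs : D.s = L ^ k) (hDL : D.L = L) (hS : StepKernelBounds (abkmWeightData L N Mord R θbar (schedDelta δ₀ δ₁ N) 𝒞) L k A𝒫' C₂ D.𝒞)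
    {x₀ : Fin d → ZMod M} (hB₀ : D.B₀ = blockOf (L ^ k) x₀) (hc₀ : D.c₀ = boxCorner (L ^ k) (starRad R L d k) x₀)
    {H H' : RelevantHamiltonian ℂ d} {b : ℝ}
    (hH : hamNorm (fieldWt h (L : ℝ) d k) ((L : ℝ) ^ k) (L ^ (d * k)) H ≤ b)
    (hH' : hamNorm (fieldWt h (L : ℝ) d k) ((L : ℝ) ^ k) (L ^ (d * k)) H' ≤ b) (hb : b ≤ 1 / 64)
    {K K' : Finset (Fin d → ZMod M) → ((Fin d → ZMod M) → ℝ) → ℂ} {C CΔ : ℝ} (hC : 0 ≤ C) (hCΔ : 0 ≤ CΔ)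
    (hK : WeakNormLE (abkmNormParams L N Mord R p r₀ h θbar A (schedDelta δ₀ δ₁ N) 𝒞) k K C)
    (hK' : WeakNormLE (abkmNormParams L N Mord R p r₀ h θbar A (schedDelta δ₀ δ₁ N) 𝒞) k K' C)
    (hΔ : WeakNormLE (abkmNormParams L N Mord R p r₀ h θbar A (schedDelta δ₀ δ₁ N) 𝒞) k (K - K') CΔ)
    (hKfac : Factorises (L ^ k) K) (hK0 : ∀ φ, K ∅ φ = 1) (hK'fac : Factorises (L ^ k) K') (hK'0 : ∀ φ, K' ∅ φ = 1)
    (hKd : ∀ Y, ContDiff ℝ r₀ (K Y)) (hK'd : ∀ Y, ContDiff ℝ r₀ (K' Y))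
    (hKloc : ∀ Y, IsPolymer (L ^ k) Y → IsConn Y → IsGaugeLocal ((abkmNormParams L N Mord R p r₀ h θbar A (schedDelta δ₀ δ₁ N) 𝒞).gauge k Y) (K Y))
    (hK'loc : ∀ Y, IsPolymer (L ^ k) Y → IsConn Y → IsGaugeLocal ((abkmNormParams L N Mord R p r₀ h θbar A (schedDelta δ₀ δ₁ N) 𝒞).gauge k Y) (K' Y))
    (hKt : TransInv (L ^ k) K) (hK't : TransInv (L ^ k) K')
    (hv : pi2BoundConst d (((2 * R + 2 : ℕ) : ℝ) + ((d / 2 + 1 : ℕ) : ℝ)) * (C * A𝒫' * A⁻¹) ≤ 1 / 64)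
    {ω : ℝ}
    (hω1 : 8 * Real.exp (1 / 4) * (2 * b + pi2BoundConst d (((2 * R + 2 : ℕ) : ℝ) + ((d / 2 + 1 : ℕ) : ℝ)) * (C * A𝒫' * A⁻¹)) + 16 * Real.exp (3 / 8) * (2 * hamNorm (fieldWt h (L : ℝ) d k) ((L : ℝ) ^ k) (L ^ (d * k)) (H - H') + pi2BoundConst d (((2 * R + 2 : ℕ) : ℝ) + ((d / 2 + 1 : ℕ) : ℝ)) * (CΔ * A𝒫' * A⁻¹)) ≤ ω)
    (hω2 : 8 * Real.exp (1 / 4) * b + 16 * Real.exp (3 / 8) * hamNorm (fieldWt h (L : ℝ) d k) ((L : ℝ) ^ k) (L ^ (d * k)) (H - H') ≤ ω)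
    (hω3 : C + CΔ ≤ ω) (hωA : ω * A ^ 2 ≤ 1)
    {κ : ℝ}
    (hκ1 : 1 + Real.exp (1 / 4) + 16 * Real.exp (3 / 8) * (2 * hamNorm (fieldWt h (L : ℝ) d k) ((L : ℝ) ^ k) (L ^ (d * k)) (H - H') + pi2BoundConst d (((2 * R + 2 : ℕ) : ℝ) + ((d / 2 + 1 : ℕ) : ℝ)) * (CΔ * A𝒫' * A⁻¹)) ≤ κ)
    (hκ2 : 1 + Real.exp (1 / 4) + 16 * Real.exp (3 / 8) * (2 * b + pi2BoundConst d (((2 * R + 2 : ℕ) : ℝ) + ((d / 2 + 1 : ℕ) : ℝ)) * (C * A𝒫' * A⁻¹)) ≤ κ)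
    (hc3A : κ ^ (L ^ d) * ((2 * (2 * κ * max 1 A𝒫')) ^ ((2 ^ (d + 1) + 2) ^ d * L ^ d) * (4 : ℝ) ^ ((2 ^ (d + 1) + 2) ^ d * L ^ d)) ≤ A ^ ((1 + 1 / ((2 * (2 ^ d + 1) + 6 : ℝ) ^ d)) - 1 : ℝ))
    (hc2A : κ ^ (L ^ d) * ((2 * κ * max 1 A𝒫') ^ ((2 ^ (d + 1) + 2) ^ d * L ^ d) * (2 : ℝ) ^ ((2 ^ (d + 1) + 2) ^ d * L ^ d)) ≤ A ^ ((1 + 1 / ((2 * (2 ^ d + 1) + 6 : ℝ) ^ d)) - 1 : ℝ)) :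
    WeakNormLE (abkmNormParams L N Mord R p r₀ h θbar A (schedDelta δ₀ δ₁ N) 𝒞) (k + 1) (fun U φ => nextKStep D H K U φ - nextKStep D H' K' U φ)
      (CΔ * ((L : ℝ) ^ d * (A𝒫' * abkmContrConst d L R) + largePartEps d L A A𝒫' (1 + 1 / ((2 * (2 ^ d + 1) + 6 : ℝ) ^ d)) + largePartEps d L A A𝒫' (1 + 1 / ((2 * (2 ^ d + 1) + 6 : ℝ) ^ d))) +
        ((L ^ d : ℕ) : ℝ) * κ ^ (L ^ d) * ((16 * Real.exp (3 / 8) * (2 * hamNorm (fieldWt h (L : ℝ) d k) ((L : ℝ) ^ k) (L ^ (d * k)) (H - H') + pi2BoundConst d (((2 * R + 2 : ℕ) : ℝ) + ((d / 2 + 1 : ℕ) : ℝ)) * (CΔ * A𝒫' * A⁻¹))) * (((1 + 8 * pi2BoundConst d (((2 * R + 2 : ℕ) : ℝ) + ((d / 2 + 1 : ℕ) : ℝ))) * (C * A𝒫' * A⁻¹)) + 256 * Real.exp (1 / 4) * ((A𝒫' + 4) * b ^ 2 + 2 * b * (pi2BoundConst d (((2 * R + 2 : ℕ) : ℝ) +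 ((d / 2 + 1 : ℕ) : ℝ)) * (C * A𝒫' * A⁻¹)) + (pi2BoundConst d (((2 * R + 2 : ℕ) : ℝ) + ((d / 2 + 1 : ℕ) : ℝ)) * (C * A𝒫' * A⁻¹)) ^ 2)) + 16 * Real.exp (3 / 8) * (2 * b + pi2BoundConst d (((2 * R + 2 : ℕ) : ℝ) + ((d / 2 + 1 : ℕ) : ℝ)) * (C * A𝒫' * A⁻¹)) * ((1 + 8 * pi2BoundConst d (((2 * R + 2 : ℕ) : ℝ) + ((d / 2 + 1 : ℕ) : ℝ))) * (CΔ * A𝒫' * A⁻¹)) + (512 * Real.exp (1 / 4) * (A𝒫' + 4) * (b + b) * hamNorm (fieldWt h (L : ℝ) d k) ((L : ℝ) ^ k) (L ^ (d * k)) (H - H') + 512 * Real.exp (1 / 4) * (hamNorm (fieldWt h (L : ℝ) d k) ((L : ℝ) ^ k) (L ^ (d * k)) (H - H') * (pi2BoundConst d (((2 * R + 2 : ℕ) : ℝ) + ((d / 2 + 1 : ℕ) : ℝ)) * (C * A𝒫' * A⁻¹)) + b * (pi2BoundConst d (((2 * R + 2 : ℕ) : ℝ) + ((d / 2 + 1 :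 ℕ) : ℝ)) * (CΔ * A𝒫' * A⁻¹))) + 256 * Real.exp (1 / 4) * (pi2BoundConst d (((2 * R + 2 : ℕ) : ℝ) + ((d / 2 + 1 : ℕ) : ℝ)) * (C * A𝒫' * A⁻¹) + pi2BoundConst d (((2 * R + 2 : ℕ) : ℝ) + ((d / 2 + 1 : ℕ) : ℝ)) * (CΔ * A𝒫' * A⁻¹)) * (pi2BoundConst d (((2 * R + 2 : ℕ) : ℝ) + ((d / 2 + 1 : ℕ) : ℝ)) * (CΔ * A𝒫' * A⁻¹)))) * A +
        (((3 * (16 * Real.exp (3 / 8) * (2 * hamNorm (fieldWt h (L : ℝ) d k) ((L : ℝ) ^ k) (L ^ (d * k)) (H - H') + pi2BoundConst d (((2 * R + 2 : ℕ) : ℝ) + ((d / 2 + 1 : ℕ) : ℝ)) * (CΔ * A𝒫' * A⁻¹))) + 16 * Real.exp (3 / 8) * hamNorm (fieldWt h (L : ℝ) d k) ((L : ℝ) ^ k) (L ^ (d * k)) (H - H') + CΔ) * (ω * A ^ 4)) + (2 * (16 * Real.exp (3 / 8) * (2 * hamNorm (fieldWt h (L : ℝ) d k) ((L : ℝ) ^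 k) (L ^ (d * k)) (H - H') + pi2BoundConst d (((2 * R + 2 : ℕ) : ℝ) + ((d / 2 + 1 : ℕ) : ℝ)) * (CΔ * A𝒫' * A⁻¹))) + CΔ)) + ((3 * (16 * Real.exp (3 / 8) * (2 * hamNorm (fieldWt h (L : ℝ) d k) ((L : ℝ) ^ k) (L ^ (d * k)) (H - H') + pi2BoundConst d (((2 * R + 2 : ℕ) : ℝ) + ((d / 2 + 1 : ℕ) : ℝ)) * (CΔ * A𝒫' * A⁻¹))) + 16 * Real.exp (3 / 8) * hamNorm (fieldWt h (L : ℝ) d k) ((L : ℝ) ^ k) (L ^ (d * k)) (H - H') + CΔ) * (ω * A ^ 4)) + ((3 * (16 * Real.exp (3 / 8) * (2 * hamNorm (fieldWt h (L : ℝ) d k) ((L : ℝ) ^ k) (L ^ (d * k)) (H - H') + pi2BoundConst d (((2 * R + 2 : ℕ) : ℝ) + ((d / 2 + 1 : ℕ) : ℝ)) * (CΔ * A𝒫' * A⁻¹))) + 16 * Real.exp (3 / 8) * hamNorm (fieldWt h (L : ℝ) d k) ((L : ℝ) ^ k) (L ^ (d * k)) (H - H') + CΔ) * (ω * A ^ 4)))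 := by
  intro U hU hUc
  have hU' : IsPolymer (L ^ (k + 1)) U := hU
  have hraw := tayNormLE_nextKStep_sub_abkm_raw_of_stepKernelBounds hd hLodd hL hR2 hM hkN hp hpM hMR hr₀ hB hδ₀ hδ₁ hh hh0
    hh2 hA𝒫 hA1 hA𝒫A hsmall D hDs hDL hS hB₀ hc₀ hU' hUc hH hH' hb hC hCΔ hK hK' hΔ hKfac hK0 hK'fac hK'0 hKd hK'd hKloc
    hK'loc hKt hK't hv hω1 hω2 hω3 hωA hκ1 hκ2
  refine hraw.mono ?_ fun φ => ((abkmWeightData L N Mord R θbar (schedDelta δ₀ δ₁ N) 𝒞).weight_pos (k + 1) U φ).le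
  -- sizes
  have hd2 : 2 ≤ d := by omega
  have hpR : p ≤ R := by omega
  have hL0 : (0 : ℝ) < L := by exact_mod_cast hLodd.pos
  have hA0 : 0 < A := by linarith
  have hsodd : Odd (L ^ k) := hLodd.pow
  have h𝔥 : 0 < fieldWt h (L : ℝ) d k := fieldWt_pos hh hL0 d k
  have hRk : (0 : ℝ) < (L : ℝ) ^ k := by positivity
  have hnn : ∀ G : RelevantHamiltonian ℂ d, 0 ≤ hamNorm (fieldWt h (L : ℝ) d k) ((L : ℝ) ^ k) (L ^ (d * k)) G :=
    fun G => hamNorm_nonneg h𝔥.le hRk.le _ _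
  have hnHH0 := hnn (H - H')
  have hb0 : 0 ≤ b := (hnn H).trans hH
  have hC87_0 : 0 ≤ pi2BoundConst d (((2 * R + 2 : ℕ) : ℝ) + ((d / 2 + 1 : ℕ) : ℝ)) := pi2BoundConst_nonneg d (by positivity)
  have hAinv : 0 ≤ A⁻¹ := inv_nonneg.2 hA0.le
  have hvΔ0 : 0 ≤ pi2BoundConst d (((2 * R + 2 : ℕ) : ℝ) + ((d / 2 + 1 : ℕ) : ℝ)) * (CΔ * A𝒫' * A⁻¹) := by positivity
  have he38 : 0 ≤ 16 * Real.exp (3 / 8) := by positivity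
  have hDP0 : 0 ≤ 16 * Real.exp (3 / 8) * (2 * hamNorm (fieldWt h (L : ℝ) d k) ((L : ℝ) ^ k) (L ^ (d * k)) (H - H') + pi2BoundConst d (((2 * R + 2 : ℕ) : ℝ) + ((d / 2 + 1 : ℕ) : ℝ)) * (CΔ * A𝒫' * A⁻¹)) := by positivity
  have hDH0 : 0 ≤ 16 * Real.exp (3 / 8) * hamNorm (fieldWt h (L : ℝ) d k) ((L : ℝ) ^ k) (L ^ (d * k)) (H - H') := by positivity
  have hω0 : 0 ≤ ω := le_trans (by positivity) hω3
  have hX34 : 0 ≤ ((3 * (16 * Real.exp (3 / 8) * (2 * hamNorm (fieldWt h (L : ℝ) d k) ((L : ℝ) ^ k) (L ^ (d * k)) (H - H') + pi2BoundConst d (((2 * R + 2 : ℕ) : ℝ) + ((d / 2 + 1 : ℕ) : ℝ)) * (CΔ * A𝒫' * A⁻¹))) + 16 * Real.exp (3 / 8) * hamNorm (fieldWt h (L : ℝ) d k) ((L : ℝ) ^ k) (L ^ (d * k)) (H - H') + CΔ) * (ω * A ^ 4)) := by positivity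
  have hX2B : 0 ≤ (2 * (16 * Real.exp (3 / 8) * (2 * hamNorm (fieldWt h (L : ℝ) d k) ((L : ℝ) ^ k) (L ^ (d * k)) (H - H') + pi2BoundConst d (((2 * R + 2 : ℕ) : ℝ) + ((d / 2 + 1 : ℕ) : ℝ)) * (CΔ * A𝒫' * A⁻¹))) + CΔ) := by positivity
  have hκ0 : 0 ≤ κ := by
    have e1 : 0 ≤ 16 * Real.exp (3 / 8) * (2 * hamNorm (fieldWt h (L : ℝ) d k) ((L : ℝ) ^ k) (L ^ (d * k)) (H - H') + pi2BoundConst d (((2 * R + 2 : ℕ) : ℝ) + ((d / 2 + 1 : ℕ) : ℝ)) * (CΔ * A𝒫' * A⁻¹)) := hDP0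
    linarith [hκ1, Real.exp_pos (1 / 4)]
  have hmax : 0 ≤ 2 * κ * max 1 A𝒫' := by positivity
  have hc3 : 0 ≤ κ ^ (L ^ d) * ((2 * (2 * κ * max 1 A𝒫')) ^ ((2 ^ (d + 1) + 2) ^ d * L ^ d) * (4 : ℝ) ^ ((2 ^ (d + 1) + 2) ^ d * L ^ d)) := by positivity
  have hc2 : 0 ≤ κ ^ (L ^ d) * ((2 * κ * max 1 A𝒫') ^ ((2 ^ (d + 1) + 2) ^ d * L ^ d) * (2 : ℝ) ^ ((2 ^ (d + 1) + 2) ^ d * L ^ d)) := by positivity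
  -- block counts: `|U|_k = L^d |U|_{k+1}`, `|U|_{k+1} ≥ 1`
  have hMeq : M = L * L ^ k * L ^ (N - k - 1) := by
    rw [hM, ← pow_succ', ← pow_add]; congr 1; omega
  have hUm : IsPolymer (L * L ^ k) U := by rw [← pow_succ']; exact hU'
  have hm0 : (blocks (L ^ k) U).card = L ^ d * (blocks (L * L ^ k) U).card :=
    TorusPolymer.card_blocks_eq_mul hMeq hsodd hLodd hLodd.pow hUm
  have hm1 : 1 ≤ (blocks (L * L ^ k) U).card := by
    obtain ⟨u, hu⟩ := hUc.1
    exact card_pos.2 ⟨blockOf (L * L ^ k) u, mem_blocks.2 ⟨u, hu, rfl⟩⟩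
  have haF : (abkmNormParams L N Mord R p r₀ h θbar A (schedDelta δ₀ δ₁ N) 𝒞).aFactor (k + 1) U = (A ^ (blocks (L * L ^ k) U).card)⁻¹ := by
    show (A ^ numBlocks (L ^ (k + 1)) U)⁻¹ = _
    rw [← card_blocks_eq_numBlocks, pow_succ']
  -- absorbing `κ^{|U|_k} c^{|U|_{k+1}}` by the gain
  have hg3 : κ ^ (blocks (L ^ k) U).card * (((2 * (2 * κ * max 1 A𝒫')) ^ ((2 ^ (d + 1) + 2) ^ d * L ^ d) * (4 : ℝ) ^ ((2 ^ (d + 1) + 2) ^ d * L ^ d)) ^ (blocks (L * L ^ k) U).card * A ^ (-((1 + 1 / ((2 * (2 ^ d + 1) + 6 : ℝ) ^ d)) * (blocks (L * L ^ k) U).card) : ℝ)) ≤ (A ^ (blocks (L * L ^ k) U).card)⁻¹ := by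
    rw [hm0, pow_mul, ← mul_assoc, ← mul_pow]
    exact TorusPolymer.pow_mul_rpow_le_inv_pow' hA1 hc3 hc3A hm1
  have hg2 : κ ^ (blocks (L ^ k) U).card * (((2 * κ * max 1 A𝒫') ^ ((2 ^ (d + 1) + 2) ^ d * L ^ d) * (2 : ℝ) ^ ((2 ^ (d + 1) + 2) ^ d * L ^ d)) ^ (blocks (L * L ^ k) U).card * A ^ (-((1 + 1 / ((2 * (2 ^ d + 1) + 6 : ℝ) ^ d)) * (blocks (L * L ^ k) U).card) : ℝ)) ≤ (A ^ (blocks (L * L ^ k) U).card)⁻¹ := by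
    rw [hm0, pow_mul, ← mul_assoc, ← mul_pow]
    exact TorusPolymer.pow_mul_rpow_le_inv_pow' hA1 hc2 hc2A hm1
  have e34 : κ ^ (blocks (L ^ k) U).card * ((3 * (16 * Real.exp (3 / 8) * (2 * hamNorm (fieldWt h (L : ℝ) d k) ((L : ℝ) ^ k) (L ^ (d * k)) (H - H') + pi2BoundConst d (((2 * R + 2 : ℕ) : ℝ) + ((d / 2 + 1 : ℕ) : ℝ)) * (CΔ * A𝒫' * A⁻¹))) + 16 * Real.exp (3 / 8) * hamNorm (fieldWt h (L : ℝ) d k) ((L : ℝ) ^ k) (L ^ (d * k)) (H - H') + CΔ) * (ω * A ^ 4)) * (((2 * (2 * κ * max 1 A𝒫')) ^ ((2 ^ (d + 1) + 2) ^ d * L ^ d) * (4 : ℝ) ^ ((2 ^ (d + 1) + 2) ^ d * L ^ d)) ^ (blocks (L * L ^ k) U).card * A ^ (-((1 + 1 / ((2 * (2 ^ d + 1) + 6 : ℝ) ^ d)) * (blocks (L * L ^ k) U).card) : ℝ)) ≤ ((3 * (16 * Real.exp (3 / 8) * (2 * hamNorm (fieldWt h (L : ℝ) d k) ((L : ℝ)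 ^ k) (L ^ (d * k)) (H - H') + pi2BoundConst d (((2 * R + 2 : ℕ) : ℝ) + ((d / 2 + 1 : ℕ) : ℝ)) * (CΔ * A𝒫' * A⁻¹))) + 16 * Real.exp (3 / 8) * hamNorm (fieldWt h (L : ℝ) d k) ((L : ℝ) ^ k) (L ^ (d * k)) (H - H') + CΔ) * (ω * A ^ 4)) * (A ^ (blocks (L * L ^ k) U).card)⁻¹ := by
    calc κ ^ (blocks (L ^ k) U).card * ((3 * (16 * Real.exp (3 / 8) * (2 * hamNorm (fieldWt h (L : ℝ) d k) ((L : ℝ) ^ k) (L ^ (d * k)) (H - H') + pi2BoundConst d (((2 * R + 2 : ℕ) : ℝ) + ((d / 2 + 1 : ℕ) : ℝ)) * (CΔ * A𝒫' * A⁻¹))) + 16 * Real.exp (3 / 8) * hamNorm (fieldWt h (L : ℝ) d k) ((L : ℝ) ^ k) (L ^ (d * k)) (H - H') + CΔ) * (ω * A ^ 4)) * (((2 * (2 * κ * max 1 A𝒫')) ^ ((2 ^ (d + 1) + 2) ^ d * L ^ d) * (4 : ℝ) ^ ((2 ^ (d + 1) + 2) ^ d * L ^ d)) ^ (blocks (L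 * L ^ k) U).card * A ^ (-((1 + 1 / ((2 * (2 ^ d + 1) + 6 : ℝ) ^ d)) * (blocks (L * L ^ k) U).card) : ℝ))
        = ((3 * (16 * Real.exp (3 / 8) * (2 * hamNorm (fieldWt h (L : ℝ) d k) ((L : ℝ) ^ k) (L ^ (d * k)) (H - H') + pi2BoundConst d (((2 * R + 2 : ℕ) : ℝ) + ((d / 2 + 1 : ℕ) : ℝ)) * (CΔ * A𝒫' * A⁻¹))) + 16 * Real.exp (3 / 8) * hamNorm (fieldWt h (L : ℝ) d k) ((L : ℝ) ^ k) (L ^ (d * k)) (H - H') + CΔ) * (ω * A ^ 4)) * (κ ^ (blocks (L ^ k) U).card * (((2 * (2 * κ * max 1 A𝒫')) ^ ((2 ^ (d + 1) + 2) ^ d * L ^ d) * (4 : ℝ) ^ ((2 ^ (d + 1) + 2) ^ d * L ^ d)) ^ (blocks (L * L ^ k) U).card * A ^ (-((1 + 1 / ((2 * (2 ^ d + 1) + 6 : ℝ) ^ d)) * (blocks (L * L ^ k) U).card) : ℝ))) := by ring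
      _ ≤ ((3 * (16 * Real.exp (3 / 8) * (2 * hamNorm (fieldWt h (L : ℝ) d k) ((L : ℝ) ^ k) (L ^ (d * k)) (H - H') + pi2BoundConst d (((2 * R + 2 : ℕ) : ℝ) + ((d / 2 + 1 : ℕ) : ℝ)) * (CΔ * A𝒫' * A⁻¹))) + 16 * Real.exp (3 / 8) * hamNorm (fieldWt h (L : ℝ) d k) ((L : ℝ) ^ k) (L ^ (d * k)) (H - H') + CΔ) * (ω * A ^ 4)) * (A ^ (blocks (L * L ^ k) U).card)⁻¹ := mul_le_mul_of_nonneg_left hg3 hX34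
  have e2B : κ ^ (blocks (L ^ k) U).card * (2 * (16 * Real.exp (3 / 8) * (2 * hamNorm (fieldWt h (L : ℝ) d k) ((L : ℝ) ^ k) (L ^ (d * k)) (H - H') + pi2BoundConst d (((2 * R + 2 : ℕ) : ℝ) + ((d / 2 + 1 : ℕ) : ℝ)) * (CΔ * A𝒫' * A⁻¹))) + CΔ) * (((2 * κ * max 1 A𝒫') ^ ((2 ^ (d + 1) + 2) ^ d * L ^ d) * (2 : ℝ) ^ ((2 ^ (d + 1) + 2) ^ d * L ^ d)) ^ (blocks (L * L ^ k) U).card * A ^ (-((1 + 1 / ((2 * (2 ^ d + 1) + 6 : ℝ) ^ d)) * (blocks (L * L ^ k) U).card) : ℝ)) ≤ (2 * (16 * Real.exp (3 / 8) * (2 * hamNorm (fieldWt h (L : ℝ) d k) ((L : ℝ) ^ k) (L ^ (d * k)) (H - H') + pi2BoundConst d (((2 * R + 2 : ℕ) : ℝ) + ((d / 2 + 1 : ℕ) : ℝ)) * (CΔ * A𝒫' * A⁻¹))) + CΔ) * (A ^ (blocks (L * L ^ k) U).card)⁻¹ := by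
    calc κ ^ (blocks (L ^ k) U).card * (2 * (16 * Real.exp (3 / 8) * (2 * hamNorm (fieldWt h (L : ℝ) d k) ((L : ℝ) ^ k) (L ^ (d * k)) (H - H') + pi2BoundConst d (((2 * R + 2 : ℕ) : ℝ) + ((d / 2 + 1 : ℕ) : ℝ)) * (CΔ * A𝒫' * A⁻¹))) + CΔ) * (((2 * κ * max 1 A𝒫') ^ ((2 ^ (d + 1) + 2) ^ d * L ^ d) * (2 : ℝ) ^ ((2 ^ (d + 1) + 2) ^ d * L ^ d)) ^ (blocks (L * L ^ k) U).card * A ^ (-((1 + 1 / ((2 * (2 ^ d + 1) + 6 : ℝ) ^ d)) * (blocks (L * L ^ k) U).card) : ℝ))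
        = (2 * (16 * Real.exp (3 / 8) * (2 * hamNorm (fieldWt h (L : ℝ) d k) ((L : ℝ) ^ k) (L ^ (d * k)) (H - H') + pi2BoundConst d (((2 * R + 2 : ℕ) : ℝ) + ((d / 2 + 1 : ℕ) : ℝ)) * (CΔ * A𝒫' * A⁻¹))) + CΔ) * (κ ^ (blocks (L ^ k) U).card * (((2 * κ * max 1 A𝒫') ^ ((2 ^ (d + 1) + 2) ^ d * L ^ d) * (2 : ℝ) ^ ((2 ^ (d + 1) + 2) ^ d * L ^ d)) ^ (blocks (L * L ^ k) U).card * A ^ (-((1 + 1 / ((2 * (2 ^ d + 1) + 6 : ℝ) ^ d)) * (blocks (L * L ^ k) U).card) : ℝ))) := by ring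
      _ ≤ (2 * (16 * Real.exp (3 / 8) * (2 * hamNorm (fieldWt h (L : ℝ) d k) ((L : ℝ) ^ k) (L ^ (d * k)) (H - H') + pi2BoundConst d (((2 * R + 2 : ℕ) : ℝ) + ((d / 2 + 1 : ℕ) : ℝ)) * (CΔ * A𝒫' * A⁻¹))) + CΔ) * (A ^ (blocks (L * L ^ k) U).card)⁻¹ := mul_le_mul_of_nonneg_left hg2 hX2B
  rw [haF]
  have hfin : CΔ * ((L : ℝ) ^ d * (A𝒫' * abkmContrConst d L R) + largePartEps d L A A𝒫' (1 + 1 / ((2 * (2 ^ d + 1) + 6 : ℝ) ^ d)) + largePartEps d L A A𝒫' (1 + 1 / ((2 * (2 ^ d + 1) + 6 : ℝ) ^ d))) * (A ^ (blocks (L * L ^ k) U).card)⁻¹ +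
        ((L ^ d : ℕ) : ℝ) * κ ^ (L ^ d) * ((16 * Real.exp (3 / 8) * (2 * hamNorm (fieldWt h (L : ℝ) d k) ((L : ℝ) ^ k) (L ^ (d * k)) (H - H') + pi2BoundConst d (((2 * R + 2 : ℕ) : ℝ) + ((d / 2 + 1 : ℕ) : ℝ)) * (CΔ * A𝒫' * A⁻¹))) * (((1 + 8 * pi2BoundConst d (((2 * R + 2 : ℕ) : ℝ) + ((d / 2 + 1 : ℕ) : ℝ))) * (C * A𝒫' * A⁻¹)) + 256 * Real.exp (1 / 4) * ((A𝒫' + 4) * b ^ 2 + 2 * b * (pi2BoundConst d (((2 * R + 2 : ℕ) : ℝ) + ((d / 2 + 1 : ℕ) : ℝ)) * (C * A𝒫' * A⁻¹)) + (pi2BoundConst d (((2 * R + 2 : ℕ) : ℝ) + ((d / 2 + 1 : ℕ) : ℝ)) * (C * A𝒫' * A⁻¹)) ^ 2)) + 16 * Real.exp (3 / 8) * (2 * b + pi2BoundConst d (((2 * R + 2 : ℕ) : ℝ) + ((d / 2 + 1 : ℕ) : ℝ)) * (C * A𝒫' * A⁻¹)) * ((1 + 8 * pi2BoundConst d (((2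 * R + 2 : ℕ) : ℝ) + ((d / 2 + 1 : ℕ) : ℝ))) * (CΔ * A𝒫' * A⁻¹)) + (512 * Real.exp (1 / 4) * (A𝒫' + 4) * (b + b) * hamNorm (fieldWt h (L : ℝ) d k) ((L : ℝ) ^ k) (L ^ (d * k)) (H - H') + 512 * Real.exp (1 / 4) * (hamNorm (fieldWt h (L : ℝ) d k) ((L : ℝ) ^ k) (L ^ (d * k)) (H - H') * (pi2BoundConst d (((2 * R + 2 : ℕ) : ℝ) + ((d / 2 + 1 : ℕ) : ℝ)) * (C * A𝒫' * A⁻¹)) + b * (pi2BoundConst d (((2 * R + 2 : ℕ) : ℝ) + ((d / 2 + 1 : ℕ) : ℝ)) * (CΔ * A𝒫' * A⁻¹))) + 256 * Real.exp (1 / 4) * (pi2BoundConst d (((2 * R + 2 : ℕ) : ℝ) + ((d / 2 + 1 : ℕ) : ℝ)) * (C * A𝒫' * A⁻¹) + pi2BoundConst d (((2 * R + 2 : ℕ) : ℝ) + ((d / 2 + 1 : ℕ) : ℝ)) * (CΔ * A𝒫' * A⁻¹)) * (pi2BoundConst d (((2 * R + 2 : ℕ) : ℝ) + ((d / 2 +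 1 : ℕ) : ℝ)) * (CΔ * A𝒫' * A⁻¹)))) * (A * (A ^ (blocks (L * L ^ k) U).card)⁻¹) +
        (((3 * (16 * Real.exp (3 / 8) * (2 * hamNorm (fieldWt h (L : ℝ) d k) ((L : ℝ) ^ k) (L ^ (d * k)) (H - H') + pi2BoundConst d (((2 * R + 2 : ℕ) : ℝ) + ((d / 2 + 1 : ℕ) : ℝ)) * (CΔ * A𝒫' * A⁻¹))) + 16 * Real.exp (3 / 8) * hamNorm (fieldWt h (L : ℝ) d k) ((L : ℝ) ^ k) (L ^ (d * k)) (H - H') + CΔ) * (ω * A ^ 4)) * (A ^ (blocks (L * L ^ k) U).card)⁻¹ + (2 * (16 * Real.exp (3 / 8) * (2 * hamNorm (fieldWt h (L : ℝ) d k) ((L : ℝ) ^ k) (L ^ (d * k)) (H - H') + pi2BoundConst d (((2 * R + 2 : ℕ) : ℝ) + ((d / 2 + 1 : ℕ) : ℝ)) * (CΔ * A𝒫' * A⁻¹))) + CΔ) * (A ^ (blocks (L * L ^ k) U).card)⁻¹) +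
        ((3 * (16 * Real.exp (3 / 8) * (2 * hamNorm (fieldWt h (L : ℝ) d k) ((L : ℝ) ^ k) (L ^ (d * k)) (H - H') + pi2BoundConst d (((2 * R + 2 : ℕ) : ℝ) + ((d / 2 + 1 : ℕ) : ℝ)) * (CΔ * A𝒫' * A⁻¹))) + 16 * Real.exp (3 / 8) * hamNorm (fieldWt h (L : ℝ) d k) ((L : ℝ) ^ k) (L ^ (d * k)) (H - H') + CΔ) * (ω * A ^ 4)) * (A ^ (blocks (L * L ^ k) U).card)⁻¹ + ((3 * (16 * Real.exp (3 / 8) * (2 * hamNorm (fieldWt h (L : ℝ) d k) ((L : ℝ) ^ k) (L ^ (d * k)) (H - H') + pi2BoundConst d (((2 * R + 2 : ℕ) : ℝ) + ((d / 2 + 1 : ℕ) : ℝ)) * (CΔ * A𝒫' * A⁻¹))) + 16 * Real.exp (3 / 8) * hamNorm (fieldWt h (L : ℝ) d k) ((L : ℝ) ^ k) (L ^ (d * k)) (H - H') + CΔ) * (ω * A ^ 4)) * (A ^ (blocks (L * L ^ k) U).card)⁻¹ =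
      (CΔ * ((L : ℝ) ^ d * (A𝒫' * abkmContrConst d L R) + largePartEps d L A A𝒫' (1 + 1 / ((2 * (2 ^ d + 1) + 6 : ℝ) ^ d)) + largePartEps d L A A𝒫' (1 + 1 / ((2 * (2 ^ d + 1) + 6 : ℝ) ^ d))) +
        ((L ^ d : ℕ) : ℝ) * κ ^ (L ^ d) * ((16 * Real.exp (3 / 8) * (2 * hamNorm (fieldWt h (L : ℝ) d k) ((L : ℝ) ^ k) (L ^ (d * k)) (H - H') + pi2BoundConst d (((2 * R + 2 : ℕ) : ℝ) + ((d / 2 + 1 : ℕ) : ℝ)) * (CΔ * A𝒫' * A⁻¹))) * (((1 + 8 * pi2BoundConst d (((2 * R + 2 : ℕ) : ℝ) + ((d / 2 + 1 : ℕ) : ℝ))) * (C * A𝒫' * A⁻¹)) + 256 * Real.exp (1 / 4) * ((A𝒫' + 4) * b ^ 2 + 2 * b * (pi2BoundConst d (((2 * R + 2 : ℕ) : ℝ) + ((d / 2 + 1 : ℕ) : ℝ)) * (C * A𝒫' * A⁻¹)) + (pi2BoundConst d (((2 * R + 2 : ℕ) : ℝ) + ((d / 2 + 1 : ℕ) : ℝ))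 * (C * A𝒫' * A⁻¹)) ^ 2)) + 16 * Real.exp (3 / 8) * (2 * b + pi2BoundConst d (((2 * R + 2 : ℕ) : ℝ) + ((d / 2 + 1 : ℕ) : ℝ)) * (C * A𝒫' * A⁻¹)) * ((1 + 8 * pi2BoundConst d (((2 * R + 2 : ℕ) : ℝ) + ((d / 2 + 1 : ℕ) : ℝ))) * (CΔ * A𝒫' * A⁻¹)) + (512 * Real.exp (1 / 4) * (A𝒫' + 4) * (b + b) * hamNorm (fieldWt h (L : ℝ) d k) ((L : ℝ) ^ k) (L ^ (d * k)) (H - H') + 512 * Real.exp (1 / 4) * (hamNorm (fieldWt h (L : ℝ) d k) ((L : ℝ) ^ k) (L ^ (d * k)) (H - H') * (pi2BoundConst d (((2 * R + 2 : ℕ) : ℝ) + ((d / 2 + 1 : ℕ) : ℝ)) * (C * A𝒫' * A⁻¹)) + b * (pi2BoundConst d (((2 * R + 2 : ℕ) : ℝ) + ((d / 2 + 1 : ℕ) : ℝ)) * (CΔ * A𝒫' * A⁻¹))) + 256 * Real.exp (1 / 4) * (pi2BoundConst d (((2 * R + 2 : ℕ) : ℝ) + ((d / 2 + 1 : ℕ)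 : ℝ)) * (C * A𝒫' * A⁻¹) + pi2BoundConst d (((2 * R + 2 : ℕ) : ℝ) + ((d / 2 + 1 : ℕ) : ℝ)) * (CΔ * A𝒫' * A⁻¹)) * (pi2BoundConst d (((2 * R + 2 : ℕ) : ℝ) + ((d / 2 + 1 : ℕ) : ℝ)) * (CΔ * A𝒫' * A⁻¹)))) * A +
        (((3 * (16 * Real.exp (3 / 8) * (2 * hamNorm (fieldWt h (L : ℝ) d k) ((L : ℝ) ^ k) (L ^ (d * k)) (H - H') + pi2BoundConst d (((2 * R + 2 : ℕ) : ℝ) + ((d / 2 + 1 : ℕ) : ℝ)) * (CΔ * A𝒫' * A⁻¹))) + 16 * Real.exp (3 / 8) * hamNorm (fieldWt h (L : ℝ) d k) ((L : ℝ) ^ k) (L ^ (d * k)) (H - H') + CΔ) * (ω * A ^ 4)) + (2 * (16 * Real.exp (3 / 8) * (2 * hamNorm (fieldWt h (L : ℝ) d k) ((L : ℝ) ^ k) (L ^ (d * k)) (H - H') + pi2BoundConst d (((2 * R + 2 : ℕ) : ℝ) + ((d / 2 + 1 : ℕ) : ℝ)) * (CΔ * A𝒫' * A⁻¹))) + CΔ))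 + ((3 * (16 * Real.exp (3 / 8) * (2 * hamNorm (fieldWt h (L : ℝ) d k) ((L : ℝ) ^ k) (L ^ (d * k)) (H - H') + pi2BoundConst d (((2 * R + 2 : ℕ) : ℝ) + ((d / 2 + 1 : ℕ) : ℝ)) * (CΔ * A𝒫' * A⁻¹))) + 16 * Real.exp (3 / 8) * hamNorm (fieldWt h (L : ℝ) d k) ((L : ℝ) ^ k) (L ^ (d * k)) (H - H') + CΔ) * (ω * A ^ 4)) + ((3 * (16 * Real.exp (3 / 8) * (2 * hamNorm (fieldWt h (L : ℝ) d k) ((L : ℝ) ^ k) (L ^ (d * k)) (H - H') + pi2BoundConst d (((2 * R + 2 : ℕ) : ℝ) + ((d / 2 + 1 : ℕ) : ℝ)) * (CΔ * A𝒫' * A⁻¹))) + 16 * Real.exp (3 / 8) * hamNorm (fieldWt h (L : ℝ) d k) ((L : ℝ) ^ k) (L ^ (d * k)) (H - H') + CΔ) * (ω * A ^ 4))) * (A ^ (blocks (L * L ^ k) U).card)⁻¹ := by ring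
  rw [← hfin]
  have h0 := le_refl (CΔ * ((L : ℝ) ^ d * (A𝒫' * abkmContrConst d L R) + largePartEps d L A A𝒫' (1 + 1 / ((2 * (2 ^ d + 1) + 6 : ℝ) ^ d)) + largePartEps d L A A𝒫' (1 + 1 / ((2 * (2 ^ d + 1) + 6 : ℝ) ^ d))) * (A ^ (blocks (L * L ^ k) U).card)⁻¹)
  have h1 := le_refl (((L ^ d : ℕ) : ℝ) * κ ^ (L ^ d) * ((16 * Real.exp (3 / 8) * (2 * hamNorm (fieldWt h (L : ℝ) d k) ((L : ℝ) ^ k) (L ^ (d * k)) (H - H') + pi2BoundConst d (((2 * R + 2 : ℕ) : ℝ) + ((d / 2 + 1 : ℕ) : ℝ)) * (CΔ * A𝒫' * A⁻¹))) * (((1 + 8 * pi2BoundConst d (((2 * R + 2 : ℕ) : ℝ) + ((d / 2 + 1 : ℕ) : ℝ))) * (C * A𝒫' * A⁻¹)) + 256 * Real.exp (1 / 4) * ((A𝒫' + 4) * b ^ 2 + 2 * b * (pi2BoundConst d (((2 * R + 2 : ℕ) : ℝ) + ((d / 2 + 1 : ℕ) : ℝ)) * (C * A𝒫' * A⁻¹))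 + (pi2BoundConst d (((2 * R + 2 : ℕ) : ℝ) + ((d / 2 + 1 : ℕ) : ℝ)) * (C * A𝒫' * A⁻¹)) ^ 2)) + 16 * Real.exp (3 / 8) * (2 * b + pi2BoundConst d (((2 * R + 2 : ℕ) : ℝ) + ((d / 2 + 1 : ℕ) : ℝ)) * (C * A𝒫' * A⁻¹)) * ((1 + 8 * pi2BoundConst d (((2 * R + 2 : ℕ) : ℝ) + ((d / 2 + 1 : ℕ) : ℝ))) * (CΔ * A𝒫' * A⁻¹)) + (512 * Real.exp (1 / 4) * (A𝒫' + 4) * (b + b) * hamNorm (fieldWt h (L : ℝ) d k) ((L : ℝ) ^ k) (L ^ (d * k)) (H - H') + 512 * Real.exp (1 / 4) * (hamNorm (fieldWt h (L : ℝ) d k) ((L : ℝ) ^ k) (L ^ (d * k)) (H - H') * (pi2BoundConst d (((2 * R + 2 : ℕ) : ℝ) + ((d / 2 + 1 : ℕ) : ℝ)) * (C * A𝒫' * A⁻¹)) + b * (pi2BoundConst d (((2 * R + 2 : ℕ) : ℝ) + ((d / 2 + 1 : ℕ) : ℝ)) * (CΔ * A𝒫' * A⁻¹))) + 256 * Real.exp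 (1 / 4) * (pi2BoundConst d (((2 * R + 2 : ℕ) : ℝ) + ((d / 2 + 1 : ℕ) : ℝ)) * (C * A𝒫' * A⁻¹) + pi2BoundConst d (((2 * R + 2 : ℕ) : ℝ) + ((d / 2 + 1 : ℕ) : ℝ)) * (CΔ * A𝒫' * A⁻¹)) * (pi2BoundConst d (((2 * R + 2 : ℕ) : ℝ) + ((d / 2 + 1 : ℕ) : ℝ)) * (CΔ * A𝒫' * A⁻¹)))) * (A * (A ^ (blocks (L * L ^ k) U).card)⁻¹))
  exact add_le_add (add_le_add (add_le_add (add_le_add h0 h1) (add_le_add e34 e2B)) e34) e34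

/-- **`‖S(H,K) − S(H',K')‖_{k+1}^{(A)} ≤ Θ_g`** (module docstring): the data of `tayNormLE_nextKStep_sub_abkm_raw_of_stepKernelBounds`
plus `κ^{L^d}·c₃ ≤ A^{η−1}` and `κ^{L^d}·c₂ ≤ A^{η−1}`; the top term keeps the gain factor
`g₂ = κ^{L^d}c₂A^{−(η−1)}`. [cite: AdamsBuchholzKoteckyMuller2019, Theorem 6.8 / Ch. 12 (12.4)] -/
theorem weakNormLE_nextKStep_sub_abkm_gain_of_stepKernelBounds {L N Mord R n p r₀ : ℕ} {θbar lam μ δ₁ δ₀ A𝒫 A𝒫' C₂ h A : ℝ}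
    {𝒞 : ℕ → (Fin d → ZMod M) → ℝ} (hd : 3 ≤ d) (hLodd : Odd L) (hL : 2 ^ (d + 3) + 16 * R ≤ L)
    (hR2 : 2 ≤ R) (hM : M = L ^ N) {k : ℕ} (hkN : k + 1 ≤ N)
    (hp : d / 2 + 2 ≤ p) (hpM : p + d ≤ Mord) (hMR : Mord ≤ R) (hr₀ : 3 ≤ r₀)
   
    (hB : AbkmWeightBounds L N Mord R n θbar lam μ δ₁ δ₀ A𝒫 𝒞
      (abkmWeightData L N Mord R θbar (schedDelta δ₀ δ₁ N) 𝒞))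
    (hδ₀ : 0 < δ₀) (hδ₁ : 0 < δ₁) (hh : 0 < h) (hh0 : hZeroSq d R δ₀ δ₁ ≤ h ^ 2)
   
    (hh2 : C₂ ≤ h ^ 2) (hA𝒫 : 0 ≤ A𝒫') (hA1 : 1 ≤ A)
    (hA𝒫A : A𝒫' ≤ A)
    (hsmall : (2 : ℝ) ^ (L ^ d) * (A𝒫' * A ^ (-(1 - (1 + 1 / ((2 * (2 ^ d + 1) + 6 : ℝ) ^ d))⁻¹) : ℝ)) ≤ 1)
    (D : StepData d M) (hDs : D.s = L ^ k) (hDL : D.L = L) (hS : StepKernelBounds (abkmWeightData L N Mord R θbar (schedDelta δ₀ δ₁ N) 𝒞) L k A𝒫' C₂ D.𝒞)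
    {x₀ : Fin d → ZMod M} (hB₀ : D.B₀ = blockOf (L ^ k) x₀) (hc₀ : D.c₀ = boxCorner (L ^ k) (starRad R L d k) x₀)
    {H H' : RelevantHamiltonian ℂ d} {b : ℝ}
    (hH : hamNorm (fieldWt h (L : ℝ) d k) ((L : ℝ) ^ k) (L ^ (d * k)) H ≤ b)
    (hH' : hamNorm (fieldWt h (L : ℝ) d k) ((L : ℝ) ^ k) (L ^ (d * k)) H' ≤ b) (hb : b ≤ 1 / 64)
    {K K' : Finset (Fin d → ZMod M) → ((Fin d → ZMod M) → ℝ) → ℂ} {C CΔ : ℝ} (hC : 0 ≤ C) (hCΔ : 0 ≤ CΔ)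
    (hK : WeakNormLE (abkmNormParams L N Mord R p r₀ h θbar A (schedDelta δ₀ δ₁ N) 𝒞) k K C)
    (hK' : WeakNormLE (abkmNormParams L N Mord R p r₀ h θbar A (schedDelta δ₀ δ₁ N) 𝒞) k K' C)
    (hΔ : WeakNormLE (abkmNormParams L N Mord R p r₀ h θbar A (schedDelta δ₀ δ₁ N) 𝒞) k (K - K') CΔ)
    (hKfac : Factorises (L ^ k) K) (hK0 : ∀ φ, K ∅ φ = 1) (hK'fac : Factorises (L ^ k) K') (hK'0 : ∀ φ, K' ∅ φ = 1)
    (hKd : ∀ Y, ContDiff ℝ r₀ (K Y)) (hK'd : ∀ Y, ContDiff ℝ r₀ (K' Y))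
    (hKloc : ∀ Y, IsPolymer (L ^ k) Y → IsConn Y → IsGaugeLocal ((abkmNormParams L N Mord R p r₀ h θbar A (schedDelta δ₀ δ₁ N) 𝒞).gauge k Y) (K Y))
    (hK'loc : ∀ Y, IsPolymer (L ^ k) Y → IsConn Y → IsGaugeLocal ((abkmNormParams L N Mord R p r₀ h θbar A (schedDelta δ₀ δ₁ N) 𝒞).gauge k Y) (K' Y))
    (hKt : TransInv (L ^ k) K) (hK't : TransInv (L ^ k) K')
    (hv : pi2BoundConst d (((2 * R + 2 : ℕ) : ℝ) + ((d / 2 + 1 : ℕ) : ℝ)) * (C * A𝒫' * A⁻¹) ≤ 1 / 64)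
    {ω : ℝ}
    (hω1 : 8 * Real.exp (1 / 4) * (2 * b + pi2BoundConst d (((2 * R + 2 : ℕ) : ℝ) + ((d / 2 + 1 : ℕ) : ℝ)) * (C * A𝒫' * A⁻¹)) + 16 * Real.exp (3 / 8) * (2 * hamNorm (fieldWt h (L : ℝ) d k) ((L : ℝ) ^ k) (L ^ (d * k)) (H - H') + pi2BoundConst d (((2 * R + 2 : ℕ) : ℝ) + ((d / 2 + 1 : ℕ) : ℝ)) * (CΔ * A𝒫' * A⁻¹)) ≤ ω)
    (hω2 : 8 * Real.exp (1 / 4) * b + 16 * Real.exp (3 / 8) * hamNorm (fieldWt h (L : ℝ) d k) ((L : ℝ) ^ k) (L ^ (d * k)) (H - H') ≤ ω)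
    (hω3 : C + CΔ ≤ ω) (hωA : ω * A ^ 2 ≤ 1)
    {κ : ℝ}
    (hκ1 : 1 + Real.exp (1 / 4) + 16 * Real.exp (3 / 8) * (2 * hamNorm (fieldWt h (L : ℝ) d k) ((L : ℝ) ^ k) (L ^ (d * k)) (H - H') + pi2BoundConst d (((2 * R + 2 : ℕ) : ℝ) + ((d / 2 + 1 : ℕ) : ℝ)) * (CΔ * A𝒫' * A⁻¹)) ≤ κ)
    (hκ2 : 1 + Real.exp (1 / 4) + 16 * Real.exp (3 / 8) * (2 * b + pi2BoundConst d (((2 * R + 2 : ℕ) : ℝ) + ((d / 2 + 1 : ℕ) : ℝ)) * (C * A𝒫' * A⁻¹)) ≤ κ)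
    (hc3A : κ ^ (L ^ d) * ((2 * (2 * κ * max 1 A𝒫')) ^ ((2 ^ (d + 1) + 2) ^ d * L ^ d) * (4 : ℝ) ^ ((2 ^ (d + 1) + 2) ^ d * L ^ d)) ≤ A ^ ((1 + 1 / ((2 * (2 ^ d + 1) + 6 : ℝ) ^ d)) - 1 : ℝ))
    (hc2A : κ ^ (L ^ d) * ((2 * κ * max 1 A𝒫') ^ ((2 ^ (d + 1) + 2) ^ d * L ^ d) * (2 : ℝ) ^ ((2 ^ (d + 1) + 2) ^ d * L ^ d)) ≤ A ^ ((1 + 1 / ((2 * (2 ^ d + 1) + 6 : ℝ) ^ d)) - 1 : ℝ)) :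
    WeakNormLE (abkmNormParams L N Mord R p r₀ h θbar A (schedDelta δ₀ δ₁ N) 𝒞) (k + 1) (fun U φ => nextKStep D H K U φ - nextKStep D H' K' U φ)
      (CΔ * ((L : ℝ) ^ d * (A𝒫' * abkmContrConst d L R) + largePartEps d L A A𝒫' (1 + 1 / ((2 * (2 ^ d + 1) + 6 : ℝ) ^ d)) + largePartEps d L A A𝒫' (1 + 1 / ((2 * (2 ^ d + 1) + 6 : ℝ) ^ d))) +
        ((L ^ d : ℕ) : ℝ) * κ ^ (L ^ d) * ((16 * Real.exp (3 / 8) * (2 * hamNorm (fieldWt h (L : ℝ) d k) ((L : ℝ) ^ k) (L ^ (d * k)) (H - H') + pi2BoundConst d (((2 * R + 2 : ℕ) : ℝ) + ((d / 2 + 1 : ℕ) : ℝ)) * (CΔ * A𝒫' * A⁻¹))) * (((1 + 8 * pi2BoundConst d (((2 * R + 2 : ℕ) : ℝ) + ((d / 2 + 1 : ℕ) : ℝ))) * (C * A𝒫' * A⁻¹)) + 256 * Real.exp (1 / 4) * ((A𝒫' + 4) * b ^ 2 + 2 * b * (pi2BoundConst d (((2 * R + 2 : ℕ) : ℝ) +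 ((d / 2 + 1 : ℕ) : ℝ)) * (C * A𝒫' * A⁻¹)) + (pi2BoundConst d (((2 * R + 2 : ℕ) : ℝ) + ((d / 2 + 1 : ℕ) : ℝ)) * (C * A𝒫' * A⁻¹)) ^ 2)) + 16 * Real.exp (3 / 8) * (2 * b + pi2BoundConst d (((2 * R + 2 : ℕ) : ℝ) + ((d / 2 + 1 : ℕ) : ℝ)) * (C * A𝒫' * A⁻¹)) * ((1 + 8 * pi2BoundConst d (((2 * R + 2 : ℕ) : ℝ) + ((d / 2 + 1 : ℕ) : ℝ))) * (CΔ * A𝒫' * A⁻¹)) + (512 * Real.exp (1 / 4) * (A𝒫' + 4) * (b + b) * hamNorm (fieldWt h (L : ℝ) d k) ((L : ℝ) ^ k) (L ^ (d * k)) (H - H') + 512 * Real.exp (1 / 4) * (hamNorm (fieldWt h (L : ℝ) d k) ((L : ℝ) ^ k) (L ^ (d * k)) (H - H') * (pi2BoundConst d (((2 * R + 2 : ℕ) : ℝ) + ((d / 2 + 1 : ℕ) : ℝ)) * (C * A𝒫' * A⁻¹)) + b * (pi2BoundConst d (((2 * R + 2 : ℕ) : ℝ) + ((d / 2 + 1 :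 ℕ) : ℝ)) * (CΔ * A𝒫' * A⁻¹))) + 256 * Real.exp (1 / 4) * (pi2BoundConst d (((2 * R + 2 : ℕ) : ℝ) + ((d / 2 + 1 : ℕ) : ℝ)) * (C * A𝒫' * A⁻¹) + pi2BoundConst d (((2 * R + 2 : ℕ) : ℝ) + ((d / 2 + 1 : ℕ) : ℝ)) * (CΔ * A𝒫' * A⁻¹)) * (pi2BoundConst d (((2 * R + 2 : ℕ) : ℝ) + ((d / 2 + 1 : ℕ) : ℝ)) * (CΔ * A𝒫' * A⁻¹)))) * A +
        (((3 * (16 * Real.exp (3 / 8) * (2 * hamNorm (fieldWt h (L : ℝ) d k) ((L : ℝ) ^ k) (L ^ (d * k)) (H - H') + pi2BoundConst d (((2 * R + 2 : ℕ) : ℝ) + ((d / 2 + 1 : ℕ) : ℝ)) * (CΔ * A𝒫' * A⁻¹))) + 16 * Real.exp (3 / 8) * hamNorm (fieldWt h (L : ℝ) d k) ((L : ℝ) ^ k) (L ^ (d * k)) (H - H') + CΔ) * (ω * A ^ 4)) + (2 * (16 * Real.exp (3 / 8) * (2 * hamNorm (fieldWt h (L : ℝ) d k) ((L : ℝ) ^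 k) (L ^ (d * k)) (H - H') + pi2BoundConst d (((2 * R + 2 : ℕ) : ℝ) + ((d / 2 + 1 : ℕ) : ℝ)) * (CΔ * A𝒫' * A⁻¹))) + CΔ) * (κ ^ (L ^ d) * ((2 * κ * max 1 A𝒫') ^ ((2 ^ (d + 1) + 2) ^ d * L ^ d) * (2 : ℝ) ^ ((2 ^ (d + 1) + 2) ^ d * L ^ d)) * A ^ (-((1 + 1 / ((2 * (2 ^ d + 1) + 6 : ℝ) ^ d)) - 1) : ℝ))) + ((3 * (16 * Real.exp (3 / 8) * (2 * hamNorm (fieldWt h (L : ℝ) d k) ((L : ℝ) ^ k) (L ^ (d * k)) (H - H') + pi2BoundConst d (((2 * R + 2 : ℕ) : ℝ) + ((d / 2 + 1 : ℕ) : ℝ)) * (CΔ * A𝒫' * A⁻¹))) + 16 * Real.exp (3 / 8) * hamNorm (fieldWt h (L : ℝ) d k) ((L : ℝ) ^ k) (L ^ (d * k)) (H - H') + CΔ) * (ω * A ^ 4)) + ((3 * (16 * Real.exp (3 / 8) * (2 * hamNorm (fieldWt h (L : ℝ) d k) ((L : ℝ) ^ k) (L ^ (d * k)) (H - H') + pi2BoundConst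 d (((2 * R + 2 : ℕ) : ℝ) + ((d / 2 + 1 : ℕ) : ℝ)) * (CΔ * A𝒫' * A⁻¹))) + 16 * Real.exp (3 / 8) * hamNorm (fieldWt h (L : ℝ) d k) ((L : ℝ) ^ k) (L ^ (d * k)) (H - H') + CΔ) * (ω * A ^ 4))) := by
  intro U hU hUc
  have hU' : IsPolymer (L ^ (k + 1)) U := hU
  have hraw := tayNormLE_nextKStep_sub_abkm_raw_of_stepKernelBounds hd hLodd hL hR2 hM hkN hp hpM hMR hr₀ hB hδ₀ hδ₁ hh hh0
    hh2 hA𝒫 hA1 hA𝒫A hsmall D hDs hDL hS hB₀ hc₀ hU' hUc hH hH' hb hC hCΔ hK hK' hΔ hKfac hK0 hK'fac hK'0 hKd hK'd hKloc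
    hK'loc hKt hK't hv hω1 hω2 hω3 hωA hκ1 hκ2
  refine hraw.mono ?_ fun φ => ((abkmWeightData L N Mord R θbar (schedDelta δ₀ δ₁ N) 𝒞).weight_pos (k + 1) U φ).le
  -- sizes
  have hd2 : 2 ≤ d := by omega
  have hpR : p ≤ R := by omega
  have hL0 : (0 : ℝ) < L := by exact_mod_cast hLodd.pos
  have hA0 : 0 < A := by linarith
  have hsodd : Odd (L ^ k) := hLodd.pow
  have h𝔥 : 0 < fieldWt h (L : ℝ) d k := fieldWt_pos hh hL0 d k
  have hRk : (0 : ℝ) < (L : ℝ) ^ k := by positivity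
  have hnn : ∀ G : RelevantHamiltonian ℂ d, 0 ≤ hamNorm (fieldWt h (L : ℝ) d k) ((L : ℝ) ^ k) (L ^ (d * k)) G :=
    fun G => hamNorm_nonneg h𝔥.le hRk.le _ _
  have hnHH0 := hnn (H - H')
  have hb0 : 0 ≤ b := (hnn H).trans hH
  have hC87_0 : 0 ≤ pi2BoundConst d (((2 * R + 2 : ℕ) : ℝ) + ((d / 2 + 1 : ℕ) : ℝ)) := pi2BoundConst_nonneg d (by positivity)
  have hAinv : 0 ≤ A⁻¹ := inv_nonneg.2 hA0.le
  have hvΔ0 : 0 ≤ pi2BoundConst d (((2 * R + 2 : ℕ) : ℝ) + ((d / 2 + 1 : ℕ) : ℝ)) * (CΔ * A𝒫' * A⁻¹) := by positivity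
  have he38 : 0 ≤ 16 * Real.exp (3 / 8) := by positivity
  have hDP0 : 0 ≤ 16 * Real.exp (3 / 8) * (2 * hamNorm (fieldWt h (L : ℝ) d k) ((L : ℝ) ^ k) (L ^ (d * k)) (H - H') + pi2BoundConst d (((2 * R + 2 : ℕ) : ℝ) + ((d / 2 + 1 : ℕ) : ℝ)) * (CΔ * A𝒫' * A⁻¹)) := by positivity
  have hDH0 : 0 ≤ 16 * Real.exp (3 / 8) * hamNorm (fieldWt h (L : ℝ) d k) ((L : ℝ) ^ k) (L ^ (d * k)) (H - H') := by positivity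
  have hω0 : 0 ≤ ω := le_trans (by positivity) hω3
  have hX34 : 0 ≤ ((3 * (16 * Real.exp (3 / 8) * (2 * hamNorm (fieldWt h (L : ℝ) d k) ((L : ℝ) ^ k) (L ^ (d * k)) (H - H') + pi2BoundConst d (((2 * R + 2 : ℕ) : ℝ) + ((d / 2 + 1 : ℕ) : ℝ)) * (CΔ * A𝒫' * A⁻¹))) + 16 * Real.exp (3 / 8) * hamNorm (fieldWt h (L : ℝ) d k) ((L : ℝ) ^ k) (L ^ (d * k)) (H - H') + CΔ) * (ω * A ^ 4)) := by positivity
  have hX2B : 0 ≤ (2 * (16 * Real.exp (3 / 8) * (2 * hamNorm (fieldWt h (L : ℝ) d k) ((L : ℝ) ^ k) (L ^ (d * k)) (H - H') + pi2BoundConst d (((2 * R + 2 : ℕ) : ℝ) + ((d / 2 + 1 : ℕ) : ℝ)) * (CΔ * A𝒫' * A⁻¹))) + CΔ) := by positivity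
  have hκ0 : 0 ≤ κ := by
    have e1 : 0 ≤ 16 * Real.exp (3 / 8) * (2 * hamNorm (fieldWt h (L : ℝ) d k) ((L : ℝ) ^ k) (L ^ (d * k)) (H - H') + pi2BoundConst d (((2 * R + 2 : ℕ) : ℝ) + ((d / 2 + 1 : ℕ) : ℝ)) * (CΔ * A𝒫' * A⁻¹)) := hDP0
    linarith [hκ1, Real.exp_pos (1 / 4)]
  have hmax : 0 ≤ 2 * κ * max 1 A𝒫' := by positivity
  have hc3 : 0 ≤ κ ^ (L ^ d) * ((2 * (2 * κ * max 1 A𝒫')) ^ ((2 ^ (d + 1) + 2) ^ d * L ^ d) * (4 : ℝ) ^ ((2 ^ (d + 1) + 2) ^ d * L ^ d)) := by positivity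
  have hc2 : 0 ≤ κ ^ (L ^ d) * ((2 * κ * max 1 A𝒫') ^ ((2 ^ (d + 1) + 2) ^ d * L ^ d) * (2 : ℝ) ^ ((2 ^ (d + 1) + 2) ^ d * L ^ d)) := by positivity
  -- block counts: `|U|_k = L^d |U|_{k+1}`, `|U|_{k+1} ≥ 1`
  have hMeq : M = L * L ^ k * L ^ (N - k - 1) := by
    rw [hM, ← pow_succ', ← pow_add]; congr 1; omega
  have hUm : IsPolymer (L * L ^ k) U := by rw [← pow_succ']; exact hU'
  have hm0 : (blocks (L ^ k) U).card = L ^ d * (blocks (L * L ^ k) U).card :=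
    TorusPolymer.card_blocks_eq_mul hMeq hsodd hLodd hLodd.pow hUm
  have hm1 : 1 ≤ (blocks (L * L ^ k) U).card := by
    obtain ⟨u, hu⟩ := hUc.1
    exact card_pos.2 ⟨blockOf (L * L ^ k) u, mem_blocks.2 ⟨u, hu, rfl⟩⟩
  have haF : (abkmNormParams L N Mord R p r₀ h θbar A (schedDelta δ₀ δ₁ N) 𝒞).aFactor (k + 1) U = (A ^ (blocks (L * L ^ k) U).card)⁻¹ := by
    show (A ^ numBlocks (L ^ (k + 1)) U)⁻¹ = _
    rw [← card_blocks_eq_numBlocks, pow_succ']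
  -- absorbing `κ^{|U|_k} c^{|U|_{k+1}}` by the gain
  have hg3 : κ ^ (blocks (L ^ k) U).card * (((2 * (2 * κ * max 1 A𝒫')) ^ ((2 ^ (d + 1) + 2) ^ d * L ^ d) * (4 : ℝ) ^ ((2 ^ (d + 1) + 2) ^ d * L ^ d)) ^ (blocks (L * L ^ k) U).card * A ^ (-((1 + 1 / ((2 * (2 ^ d + 1) + 6 : ℝ) ^ d)) * (blocks (L * L ^ k) U).card) : ℝ)) ≤ (A ^ (blocks (L * L ^ k) U).card)⁻¹ := by
    rw [hm0, pow_mul, ← mul_assoc, ← mul_pow]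
    exact TorusPolymer.pow_mul_rpow_le_inv_pow' hA1 hc3 hc3A hm1
  have hg2 : κ ^ (blocks (L ^ k) U).card * (((2 * κ * max 1 A𝒫') ^ ((2 ^ (d + 1) + 2) ^ d * L ^ d) * (2 : ℝ) ^ ((2 ^ (d + 1) + 2) ^ d * L ^ d)) ^ (blocks (L * L ^ k) U).card * A ^ (-((1 + 1 / ((2 * (2 ^ d + 1) + 6 : ℝ) ^ d)) * (blocks (L * L ^ k) U).card) : ℝ)) ≤ (κ ^ (L ^ d) * ((2 * κ * max 1 A𝒫') ^ ((2 ^ (d + 1) + 2) ^ d * L ^ d) * (2 : ℝ) ^ ((2 ^ (d + 1) + 2) ^ d * L ^ d)) * A ^ (-((1 + 1 / ((2 * (2 ^ d + 1) + 6 : ℝ) ^ d)) - 1) : ℝ)) * (A ^ (blocks (L * L ^ k) U).card)⁻¹ := by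
    rw [hm0, pow_mul, ← mul_assoc, ← mul_pow]
    exact TorusPolymer.pow_mul_rpow_le_inv_pow hA1 hc2 hc2A hm1
  have e34 : κ ^ (blocks (L ^ k) U).card * ((3 * (16 * Real.exp (3 / 8) * (2 * hamNorm (fieldWt h (L : ℝ) d k) ((L : ℝ) ^ k) (L ^ (d * k)) (H - H') + pi2BoundConst d (((2 * R + 2 : ℕ) : ℝ) + ((d / 2 + 1 : ℕ) : ℝ)) * (CΔ * A𝒫' * A⁻¹))) + 16 * Real.exp (3 / 8) * hamNorm (fieldWt h (L : ℝ) d k) ((L : ℝ) ^ k) (L ^ (d * k)) (H - H') + CΔ) * (ω * A ^ 4)) * (((2 * (2 * κ * max 1 A𝒫')) ^ ((2 ^ (d + 1) + 2) ^ d * L ^ d) * (4 : ℝ) ^ ((2 ^ (d + 1) + 2) ^ d * L ^ d)) ^ (blocks (L * L ^ k) U).card * A ^ (-((1 + 1 / ((2 * (2 ^ d + 1) + 6 : ℝ) ^ d)) * (blocks (L * L ^ k) U).card) : ℝ)) ≤ ((3 * (16 * Real.exp (3 / 8) * (2 * hamNorm (fieldWt h (L : ℝ) d k) ((L : ℝ)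 ^ k) (L ^ (d * k)) (H - H') + pi2BoundConst d (((2 * R + 2 : ℕ) : ℝ) + ((d / 2 + 1 : ℕ) : ℝ)) * (CΔ * A𝒫' * A⁻¹))) + 16 * Real.exp (3 / 8) * hamNorm (fieldWt h (L : ℝ) d k) ((L : ℝ) ^ k) (L ^ (d * k)) (H - H') + CΔ) * (ω * A ^ 4)) * (A ^ (blocks (L * L ^ k) U).card)⁻¹ := by
    calc κ ^ (blocks (L ^ k) U).card * ((3 * (16 * Real.exp (3 / 8) * (2 * hamNorm (fieldWt h (L : ℝ) d k) ((L : ℝ) ^ k) (L ^ (d * k)) (H - H') + pi2BoundConst d (((2 * R + 2 : ℕ) : ℝ) + ((d / 2 + 1 : ℕ) : ℝ)) * (CΔ * A𝒫' * A⁻¹))) + 16 * Real.exp (3 / 8) * hamNorm (fieldWt h (L : ℝ) d k) ((L : ℝ) ^ k) (L ^ (d * k)) (H - H') + CΔ) * (ω * A ^ 4)) * (((2 * (2 * κ * max 1 A𝒫')) ^ ((2 ^ (d + 1) + 2) ^ d * L ^ d) * (4 : ℝ) ^ ((2 ^ (d + 1) + 2) ^ d * L ^ d)) ^ (blocks (L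 * L ^ k) U).card * A ^ (-((1 + 1 / ((2 * (2 ^ d + 1) + 6 : ℝ) ^ d)) * (blocks (L * L ^ k) U).card) : ℝ))
        = ((3 * (16 * Real.exp (3 / 8) * (2 * hamNorm (fieldWt h (L : ℝ) d k) ((L : ℝ) ^ k) (L ^ (d * k)) (H - H') + pi2BoundConst d (((2 * R + 2 : ℕ) : ℝ) + ((d / 2 + 1 : ℕ) : ℝ)) * (CΔ * A𝒫' * A⁻¹))) + 16 * Real.exp (3 / 8) * hamNorm (fieldWt h (L : ℝ) d k) ((L : ℝ) ^ k) (L ^ (d * k)) (H - H') + CΔ) * (ω * A ^ 4)) * (κ ^ (blocks (L ^ k) U).card * (((2 * (2 * κ * max 1 A𝒫')) ^ ((2 ^ (d + 1) + 2) ^ d * L ^ d) * (4 : ℝ) ^ ((2 ^ (d + 1) + 2) ^ d * L ^ d)) ^ (blocks (L * L ^ k) U).card * A ^ (-((1 + 1 / ((2 * (2 ^ d + 1) + 6 : ℝ) ^ d)) * (blocks (L * L ^ k) U).card) : ℝ))) := by ring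
      _ ≤ ((3 * (16 * Real.exp (3 / 8) * (2 * hamNorm (fieldWt h (L : ℝ) d k) ((L : ℝ) ^ k) (L ^ (d * k)) (H - H') + pi2BoundConst d (((2 * R + 2 : ℕ) : ℝ) + ((d / 2 + 1 : ℕ) : ℝ)) * (CΔ * A𝒫' * A⁻¹))) + 16 * Real.exp (3 / 8) * hamNorm (fieldWt h (L : ℝ) d k) ((L : ℝ) ^ k) (L ^ (d * k)) (H - H') + CΔ) * (ω * A ^ 4)) * (A ^ (blocks (L * L ^ k) U).card)⁻¹ := mul_le_mul_of_nonneg_left hg3 hX34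
  have e2B : κ ^ (blocks (L ^ k) U).card * (2 * (16 * Real.exp (3 / 8) * (2 * hamNorm (fieldWt h (L : ℝ) d k) ((L : ℝ) ^ k) (L ^ (d * k)) (H - H') + pi2BoundConst d (((2 * R + 2 : ℕ) : ℝ) + ((d / 2 + 1 : ℕ) : ℝ)) * (CΔ * A𝒫' * A⁻¹))) + CΔ) * (((2 * κ * max 1 A𝒫') ^ ((2 ^ (d + 1) + 2) ^ d * L ^ d) * (2 : ℝ) ^ ((2 ^ (d + 1) + 2) ^ d * L ^ d)) ^ (blocks (L * L ^ k) U).card * A ^ (-((1 + 1 / ((2 * (2 ^ d + 1) + 6 : ℝ) ^ d)) * (blocks (L * L ^ k) U).card) : ℝ)) ≤ (2 * (16 * Real.exp (3 / 8) * (2 * hamNorm (fieldWt h (L : ℝ) d k) ((L : ℝ) ^ k) (L ^ (d * k)) (H - H') + pi2BoundConst d (((2 * R + 2 : ℕ) : ℝ) + ((d / 2 + 1 : ℕ) : ℝ)) * (CΔ * A𝒫' * A⁻¹))) + CΔ) * (κ ^ (L ^ d) * ((2 * κ * max 1 A𝒫') ^ ((2 ^ (d + 1) + 2) ^ d * L ^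 d) * (2 : ℝ) ^ ((2 ^ (d + 1) + 2) ^ d * L ^ d)) * A ^ (-((1 + 1 / ((2 * (2 ^ d + 1) + 6 : ℝ) ^ d)) - 1) : ℝ)) * (A ^ (blocks (L * L ^ k) U).card)⁻¹ := by
    calc κ ^ (blocks (L ^ k) U).card * (2 * (16 * Real.exp (3 / 8) * (2 * hamNorm (fieldWt h (L : ℝ) d k) ((L : ℝ) ^ k) (L ^ (d * k)) (H - H') + pi2BoundConst d (((2 * R + 2 : ℕ) : ℝ) + ((d / 2 + 1 : ℕ) : ℝ)) * (CΔ * A𝒫' * A⁻¹))) + CΔ) * (((2 * κ * max 1 A𝒫') ^ ((2 ^ (d + 1) + 2) ^ d * L ^ d) * (2 : ℝ) ^ ((2 ^ (d + 1) + 2) ^ d * L ^ d)) ^ (blocks (L * L ^ k) U).card * A ^ (-((1 + 1 / ((2 * (2 ^ d + 1) + 6 : ℝ) ^ d)) * (blocks (L * L ^ k) U).card) : ℝ))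
        = (2 * (16 * Real.exp (3 / 8) * (2 * hamNorm (fieldWt h (L : ℝ) d k) ((L : ℝ) ^ k) (L ^ (d * k)) (H - H') + pi2BoundConst d (((2 * R + 2 : ℕ) : ℝ) + ((d / 2 + 1 : ℕ) : ℝ)) * (CΔ * A𝒫' * A⁻¹))) + CΔ) * (κ ^ (blocks (L ^ k) U).card * (((2 * κ * max 1 A𝒫') ^ ((2 ^ (d + 1) + 2) ^ d * L ^ d) * (2 : ℝ) ^ ((2 ^ (d + 1) + 2) ^ d * L ^ d)) ^ (blocks (L * L ^ k) U).card * A ^ (-((1 + 1 / ((2 * (2 ^ d + 1) + 6 : ℝ) ^ d)) * (blocks (L * L ^ k) U).card) : ℝ))) := by ring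
      _ ≤ (2 * (16 * Real.exp (3 / 8) * (2 * hamNorm (fieldWt h (L : ℝ) d k) ((L : ℝ) ^ k) (L ^ (d * k)) (H - H') + pi2BoundConst d (((2 * R + 2 : ℕ) : ℝ) + ((d / 2 + 1 : ℕ) : ℝ)) * (CΔ * A𝒫' * A⁻¹))) + CΔ) * ((κ ^ (L ^ d) * ((2 * κ * max 1 A𝒫') ^ ((2 ^ (d + 1) + 2) ^ d * L ^ d) * (2 : ℝ) ^ ((2 ^ (d + 1) + 2) ^ d * L ^ d)) * A ^ (-((1 + 1 / ((2 * (2 ^ d + 1) + 6 : ℝ) ^ d)) - 1) : ℝ)) * (A ^ (blocks (L * L ^ k) U).card)⁻¹) := mul_le_mul_of_nonneg_left hg2 hX2B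
      _ = (2 * (16 * Real.exp (3 / 8) * (2 * hamNorm (fieldWt h (L : ℝ) d k) ((L : ℝ) ^ k) (L ^ (d * k)) (H - H') + pi2BoundConst d (((2 * R + 2 : ℕ) : ℝ) + ((d / 2 + 1 : ℕ) : ℝ)) * (CΔ * A𝒫' * A⁻¹))) + CΔ) * (κ ^ (L ^ d) * ((2 * κ * max 1 A𝒫') ^ ((2 ^ (d + 1) + 2) ^ d * L ^ d) * (2 : ℝ) ^ ((2 ^ (d + 1) + 2) ^ d * L ^ d)) * A ^ (-((1 + 1 / ((2 * (2 ^ d + 1) + 6 : ℝ) ^ d)) - 1) : ℝ)) * (A ^ (blocks (L * L ^ k) U).card)⁻¹ := by ring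
  rw [haF]
  have hfin : CΔ * ((L : ℝ) ^ d * (A𝒫' * abkmContrConst d L R) + largePartEps d L A A𝒫' (1 + 1 / ((2 * (2 ^ d + 1) + 6 : ℝ) ^ d)) + largePartEps d L A A𝒫' (1 + 1 / ((2 * (2 ^ d + 1) + 6 : ℝ) ^ d))) * (A ^ (blocks (L * L ^ k) U).card)⁻¹ +
        ((L ^ d : ℕ) : ℝ) * κ ^ (L ^ d) * ((16 * Real.exp (3 / 8) * (2 * hamNorm (fieldWt h (L : ℝ) d k) ((L : ℝ) ^ k) (L ^ (d * k)) (H - H') + pi2BoundConst d (((2 * R + 2 : ℕ) : ℝ) + ((d / 2 + 1 : ℕ) : ℝ)) * (CΔ * A𝒫' * A⁻¹))) * (((1 + 8 * pi2BoundConst d (((2 * R + 2 : ℕ) : ℝ) + ((d / 2 + 1 : ℕ) : ℝ))) * (C * A𝒫' * A⁻¹)) + 256 * Real.exp (1 / 4) * ((A𝒫' + 4) * b ^ 2 + 2 * b * (pi2BoundConst d (((2 * R + 2 : ℕ) : ℝ) + ((d / 2 + 1 : ℕ) : ℝ)) * (C * A𝒫' * A⁻¹)) + (pi2BoundConst d (((2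 * R + 2 : ℕ) : ℝ) + ((d / 2 + 1 : ℕ) : ℝ)) * (C * A𝒫' * A⁻¹)) ^ 2)) + 16 * Real.exp (3 / 8) * (2 * b + pi2BoundConst d (((2 * R + 2 : ℕ) : ℝ) + ((d / 2 + 1 : ℕ) : ℝ)) * (C * A𝒫' * A⁻¹)) * ((1 + 8 * pi2BoundConst d (((2 * R + 2 : ℕ) : ℝ) + ((d / 2 + 1 : ℕ) : ℝ))) * (CΔ * A𝒫' * A⁻¹)) + (512 * Real.exp (1 / 4) * (A𝒫' + 4) * (b + b) * hamNorm (fieldWt h (L : ℝ) d k) ((L : ℝ) ^ k) (L ^ (d * k)) (H - H') + 512 * Real.exp (1 / 4) * (hamNorm (fieldWt h (L : ℝ) d k) ((L : ℝ) ^ k) (L ^ (d * k)) (H - H') * (pi2BoundConst d (((2 * R + 2 : ℕ) : ℝ) + ((d / 2 + 1 : ℕ) : ℝ)) * (C * A𝒫' * A⁻¹)) + b * (pi2BoundConst d (((2 * R + 2 : ℕ) : ℝ) + ((d / 2 + 1 : ℕ) : ℝ)) * (CΔ * A𝒫' * A⁻¹))) + 256 * Real.exp (1 / 4) * (pi2BoundConst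 d (((2 * R + 2 : ℕ) : ℝ) + ((d / 2 + 1 : ℕ) : ℝ)) * (C * A𝒫' * A⁻¹) + pi2BoundConst d (((2 * R + 2 : ℕ) : ℝ) + ((d / 2 + 1 : ℕ) : ℝ)) * (CΔ * A𝒫' * A⁻¹)) * (pi2BoundConst d (((2 * R + 2 : ℕ) : ℝ) + ((d / 2 + 1 : ℕ) : ℝ)) * (CΔ * A𝒫' * A⁻¹)))) * (A * (A ^ (blocks (L * L ^ k) U).card)⁻¹) +
        (((3 * (16 * Real.exp (3 / 8) * (2 * hamNorm (fieldWt h (L : ℝ) d k) ((L : ℝ) ^ k) (L ^ (d * k)) (H - H') + pi2BoundConst d (((2 * R + 2 : ℕ) : ℝ) + ((d / 2 + 1 : ℕ) : ℝ)) * (CΔ * A𝒫' * A⁻¹))) + 16 * Real.exp (3 / 8) * hamNorm (fieldWt h (L : ℝ) d k) ((L : ℝ) ^ k) (L ^ (d * k)) (H - H') + CΔ) * (ω * A ^ 4)) * (A ^ (blocks (L * L ^ k) U).card)⁻¹ + (2 * (16 * Real.exp (3 / 8) * (2 * hamNorm (fieldWt h (L : ℝ) d k) ((L : ℝ) ^ k)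 (L ^ (d * k)) (H - H') + pi2BoundConst d (((2 * R + 2 : ℕ) : ℝ) + ((d / 2 + 1 : ℕ) : ℝ)) * (CΔ * A𝒫' * A⁻¹))) + CΔ) * (κ ^ (L ^ d) * ((2 * κ * max 1 A𝒫') ^ ((2 ^ (d + 1) + 2) ^ d * L ^ d) * (2 : ℝ) ^ ((2 ^ (d + 1) + 2) ^ d * L ^ d)) * A ^ (-((1 + 1 / ((2 * (2 ^ d + 1) + 6 : ℝ) ^ d)) - 1) : ℝ)) * (A ^ (blocks (L * L ^ k) U).card)⁻¹) +
        ((3 * (16 * Real.exp (3 / 8) * (2 * hamNorm (fieldWt h (L : ℝ) d k) ((L : ℝ) ^ k) (L ^ (d * k)) (H - H') + pi2BoundConst d (((2 * R + 2 : ℕ) : ℝ) + ((d / 2 + 1 : ℕ) : ℝ)) * (CΔ * A𝒫' * A⁻¹))) + 16 * Real.exp (3 / 8) * hamNorm (fieldWt h (L : ℝ) d k) ((L : ℝ) ^ k) (L ^ (d * k)) (H - H') + CΔ) * (ω * A ^ 4)) * (A ^ (blocks (L * L ^ k) U).card)⁻¹ + ((3 * (16 * Real.exp (3 / 8) * (2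 * hamNorm (fieldWt h (L : ℝ) d k) ((L : ℝ) ^ k) (L ^ (d * k)) (H - H') + pi2BoundConst d (((2 * R + 2 : ℕ) : ℝ) + ((d / 2 + 1 : ℕ) : ℝ)) * (CΔ * A𝒫' * A⁻¹))) + 16 * Real.exp (3 / 8) * hamNorm (fieldWt h (L : ℝ) d k) ((L : ℝ) ^ k) (L ^ (d * k)) (H - H') + CΔ) * (ω * A ^ 4)) * (A ^ (blocks (L * L ^ k) U).card)⁻¹ =
      (CΔ * ((L : ℝ) ^ d * (A𝒫' * abkmContrConst d L R) + largePartEps d L A A𝒫' (1 + 1 / ((2 * (2 ^ d + 1) + 6 : ℝ) ^ d)) + largePartEps d L A A𝒫' (1 + 1 / ((2 * (2 ^ d + 1) + 6 : ℝ) ^ d))) +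
        ((L ^ d : ℕ) : ℝ) * κ ^ (L ^ d) * ((16 * Real.exp (3 / 8) * (2 * hamNorm (fieldWt h (L : ℝ) d k) ((L : ℝ) ^ k) (L ^ (d * k)) (H - H') + pi2BoundConst d (((2 * R + 2 : ℕ) : ℝ) + ((d / 2 + 1 : ℕ) : ℝ)) * (CΔ * A𝒫' * A⁻¹))) * (((1 + 8 * pi2BoundConst d (((2 * R + 2 : ℕ) : ℝ) + ((d / 2 + 1 : ℕ) : ℝ))) * (C * A𝒫' * A⁻¹)) + 256 * Real.exp (1 / 4) * ((A𝒫' + 4) * b ^ 2 + 2 * b * (pi2BoundConst d (((2 * R + 2 : ℕ) : ℝ) + ((d / 2 + 1 : ℕ) : ℝ)) * (C * A𝒫' * A⁻¹)) + (pi2BoundConst d (((2 * R + 2 : ℕ) : ℝ) + ((d / 2 + 1 : ℕ) : ℝ)) * (C * A𝒫' * A⁻¹)) ^ 2)) + 16 * Real.exp (3 / 8) * (2 * b + pi2BoundConst d (((2 * R + 2 : ℕ) : ℝ) + ((d / 2 + 1 : ℕ) : ℝ)) * (C * A𝒫' * A⁻¹)) * ((1 + 8 * pi2BoundConst d (((2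 * R + 2 : ℕ) : ℝ) + ((d / 2 + 1 : ℕ) : ℝ))) * (CΔ * A𝒫' * A⁻¹)) + (512 * Real.exp (1 / 4) * (A𝒫' + 4) * (b + b) * hamNorm (fieldWt h (L : ℝ) d k) ((L : ℝ) ^ k) (L ^ (d * k)) (H - H') + 512 * Real.exp (1 / 4) * (hamNorm (fieldWt h (L : ℝ) d k) ((L : ℝ) ^ k) (L ^ (d * k)) (H - H') * (pi2BoundConst d (((2 * R + 2 : ℕ) : ℝ) + ((d / 2 + 1 : ℕ) : ℝ)) * (C * A𝒫' * A⁻¹)) + b * (pi2BoundConst d (((2 * R + 2 : ℕ) : ℝ) + ((d / 2 + 1 : ℕ) : ℝ)) * (CΔ * A𝒫' * A⁻¹))) + 256 * Real.exp (1 / 4) * (pi2BoundConst d (((2 * R + 2 : ℕ) : ℝ) + ((d / 2 + 1 : ℕ) : ℝ)) * (C * A𝒫' * A⁻¹) + pi2BoundConst d (((2 * R + 2 : ℕ) : ℝ) + ((d / 2 + 1 : ℕ) : ℝ)) * (CΔ * A𝒫' * A⁻¹)) * (pi2BoundConst d (((2 * R + 2 : ℕ) : ℝ) + ((d / 2 +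 1 : ℕ) : ℝ)) * (CΔ * A𝒫' * A⁻¹)))) * A +
        (((3 * (16 * Real.exp (3 / 8) * (2 * hamNorm (fieldWt h (L : ℝ) d k) ((L : ℝ) ^ k) (L ^ (d * k)) (H - H') + pi2BoundConst d (((2 * R + 2 : ℕ) : ℝ) + ((d / 2 + 1 : ℕ) : ℝ)) * (CΔ * A𝒫' * A⁻¹))) + 16 * Real.exp (3 / 8) * hamNorm (fieldWt h (L : ℝ) d k) ((L : ℝ) ^ k) (L ^ (d * k)) (H - H') + CΔ) * (ω * A ^ 4)) + (2 * (16 * Real.exp (3 / 8) * (2 * hamNorm (fieldWt h (L : ℝ) d k) ((L : ℝ) ^ k) (L ^ (d * k)) (H - H') + pi2BoundConst d (((2 * R + 2 : ℕ) : ℝ) + ((d / 2 + 1 : ℕ) : ℝ)) * (CΔ * A𝒫' * A⁻¹))) + CΔ) * (κ ^ (L ^ d) * ((2 * κ * max 1 A𝒫') ^ ((2 ^ (d + 1) + 2) ^ d * L ^ d) * (2 : ℝ) ^ ((2 ^ (d + 1) + 2) ^ d * L ^ d)) * A ^ (-((1 + 1 / ((2 * (2 ^ d + 1) + 6 : ℝ)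 ^ d)) - 1) : ℝ))) + ((3 * (16 * Real.exp (3 / 8) * (2 * hamNorm (fieldWt h (L : ℝ) d k) ((L : ℝ) ^ k) (L ^ (d * k)) (H - H') + pi2BoundConst d (((2 * R + 2 : ℕ) : ℝ) + ((d / 2 + 1 : ℕ) : ℝ)) * (CΔ * A𝒫' * A⁻¹))) + 16 * Real.exp (3 / 8) * hamNorm (fieldWt h (L : ℝ) d k) ((L : ℝ) ^ k) (L ^ (d * k)) (H - H') + CΔ) * (ω * A ^ 4)) + ((3 * (16 * Real.exp (3 / 8) * (2 * hamNorm (fieldWt h (L : ℝ) d k) ((L : ℝ) ^ k) (L ^ (d * k)) (H - H') + pi2BoundConst d (((2 * R + 2 : ℕ) : ℝ) + ((d / 2 + 1 : ℕ) : ℝ)) * (CΔ * A𝒫' * A⁻¹))) + 16 * Real.exp (3 / 8) * hamNorm (fieldWt h (L : ℝ) d k) ((L : ℝ) ^ k) (L ^ (d * k)) (H - H') + CΔ) * (ω * A ^ 4))) * (A ^ (blocks (L * L ^ k) U).card)⁻¹ := by ring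
  rw [← hfin]
  have h0 := le_refl (CΔ * ((L : ℝ) ^ d * (A𝒫' * abkmContrConst d L R) + largePartEps d L A A𝒫' (1 + 1 / ((2 * (2 ^ d + 1) + 6 : ℝ) ^ d)) + largePartEps d L A A𝒫' (1 + 1 / ((2 * (2 ^ d + 1) + 6 : ℝ) ^ d))) * (A ^ (blocks (L * L ^ k) U).card)⁻¹)
  have h1 := le_refl (((L ^ d : ℕ) : ℝ) * κ ^ (L ^ d) * ((16 * Real.exp (3 / 8) * (2 * hamNorm (fieldWt h (L : ℝ) d k) ((L : ℝ) ^ k) (L ^ (d * k)) (H - H') + pi2BoundConst d (((2 * R + 2 : ℕ) : ℝ) + ((d / 2 + 1 : ℕ) : ℝ)) * (CΔ * A𝒫' * A⁻¹))) * (((1 + 8 * pi2BoundConst d (((2 * R + 2 : ℕ) : ℝ) + ((d / 2 + 1 : ℕ) : ℝ))) * (C * A𝒫' * A⁻¹)) + 256 * Real.exp (1 / 4) * ((A𝒫' + 4) * b ^ 2 + 2 * b * (pi2BoundConst d (((2 * R + 2 : ℕ) : ℝ) + ((d / 2 + 1 : ℕ) : ℝ)) * (C * A𝒫' * A⁻¹))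 + (pi2BoundConst d (((2 * R + 2 : ℕ) : ℝ) + ((d / 2 + 1 : ℕ) : ℝ)) * (C * A𝒫' * A⁻¹)) ^ 2)) + 16 * Real.exp (3 / 8) * (2 * b + pi2BoundConst d (((2 * R + 2 : ℕ) : ℝ) + ((d / 2 + 1 : ℕ) : ℝ)) * (C * A𝒫' * A⁻¹)) * ((1 + 8 * pi2BoundConst d (((2 * R + 2 : ℕ) : ℝ) + ((d / 2 + 1 : ℕ) : ℝ))) * (CΔ * A𝒫' * A⁻¹)) + (512 * Real.exp (1 / 4) * (A𝒫' + 4) * (b + b) * hamNorm (fieldWt h (L : ℝ) d k) ((L : ℝ) ^ k) (L ^ (d * k)) (H - H') + 512 * Real.exp (1 / 4) * (hamNorm (fieldWt h (L : ℝ) d k) ((L : ℝ) ^ k) (L ^ (d * k)) (H - H') * (pi2BoundConst d (((2 * R + 2 : ℕ) : ℝ) + ((d / 2 + 1 : ℕ) : ℝ)) * (C * A𝒫' * A⁻¹)) + b * (pi2BoundConst d (((2 * R + 2 : ℕ) : ℝ) + ((d / 2 + 1 : ℕ) : ℝ)) * (CΔ * A𝒫' * A⁻¹))) + 256 * Real.exp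 (1 / 4) * (pi2BoundConst d (((2 * R + 2 : ℕ) : ℝ) + ((d / 2 + 1 : ℕ) : ℝ)) * (C * A𝒫' * A⁻¹) + pi2BoundConst d (((2 * R + 2 : ℕ) : ℝ) + ((d / 2 + 1 : ℕ) : ℝ)) * (CΔ * A𝒫' * A⁻¹)) * (pi2BoundConst d (((2 * R + 2 : ℕ) : ℝ) + ((d / 2 + 1 : ℕ) : ℝ)) * (CΔ * A𝒫' * A⁻¹)))) * (A * (A ^ (blocks (L * L ^ k) U).card)⁻¹))
  exact add_le_add (add_le_add (add_le_add (add_le_add h0 h1) (add_le_add e34 e2B)) e34) e34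

/-- **`σ`-Lipschitz form of `S_k` with gain** (module docstring): the data of `weakNormLE_nextKStep_sub_abkm_gain_of_stepKernelBounds` and `C_Δ ≤ 2C`;
`Θ_H` (coefficient of `‖H−H'‖_{k,0}`) and `Θ_K` (coefficient of `C_Δ`) are the displayed explicit constants.
[cite: AdamsBuchholzKoteckyMuller2019, Theorem 6.8 / Ch. 12 (12.4)] -/
theorem weakNormLE_nextKStep_sub_abkm_max_gain_of_stepKernelBounds {L N Mord R n p r₀ : ℕ} {θbar lam μ δ₁ δ₀ A𝒫 A𝒫' C₂ h A : ℝ}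
    {𝒞 : ℕ → (Fin d → ZMod M) → ℝ} (hd : 3 ≤ d) (hLodd : Odd L) (hL : 2 ^ (d + 3) + 16 * R ≤ L)
    (hR2 : 2 ≤ R) (hM : M = L ^ N) {k : ℕ} (hkN : k + 1 ≤ N)
    (hp : d / 2 + 2 ≤ p) (hpM : p + d ≤ Mord) (hMR : Mord ≤ R) (hr₀ : 3 ≤ r₀)
   
    (hB : AbkmWeightBounds L N Mord R n θbar lam μ δ₁ δ₀ A𝒫 𝒞
      (abkmWeightData L N Mord R θbar (schedDelta δ₀ δ₁ N) 𝒞))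
    (hδ₀ : 0 < δ₀) (hδ₁ : 0 < δ₁) (hh : 0 < h) (hh0 : hZeroSq d R δ₀ δ₁ ≤ h ^ 2)
   
    (hh2 : C₂ ≤ h ^ 2) (hA𝒫 : 0 ≤ A𝒫') (hA1 : 1 ≤ A)
    (hA𝒫A : A𝒫' ≤ A)
    (hsmall : (2 : ℝ) ^ (L ^ d) * (A𝒫' * A ^ (-(1 - (1 + 1 / ((2 * (2 ^ d + 1) + 6 : ℝ) ^ d))⁻¹) : ℝ)) ≤ 1)
    (D : StepData d M) (hDs : D.s = L ^ k) (hDL : D.L = L) (hS : StepKernelBounds (abkmWeightData L N Mord R θbar (schedDelta δ₀ δ₁ N) 𝒞) L k A𝒫' C₂ D.𝒞)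
    {x₀ : Fin d → ZMod M} (hB₀ : D.B₀ = blockOf (L ^ k) x₀) (hc₀ : D.c₀ = boxCorner (L ^ k) (starRad R L d k) x₀)
    {H H' : RelevantHamiltonian ℂ d} {b : ℝ}
    (hH : hamNorm (fieldWt h (L : ℝ) d k) ((L : ℝ) ^ k) (L ^ (d * k)) H ≤ b)
    (hH' : hamNorm (fieldWt h (L : ℝ) d k) ((L : ℝ) ^ k) (L ^ (d * k)) H' ≤ b) (hb : b ≤ 1 / 64)
    {K K' : Finset (Fin d → ZMod M) → ((Fin d → ZMod M) → ℝ) → ℂ} {C CΔ : ℝ} (hC : 0 ≤ C) (hCΔ : 0 ≤ CΔ)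
    (hK : WeakNormLE (abkmNormParams L N Mord R p r₀ h θbar A (schedDelta δ₀ δ₁ N) 𝒞) k K C)
    (hK' : WeakNormLE (abkmNormParams L N Mord R p r₀ h θbar A (schedDelta δ₀ δ₁ N) 𝒞) k K' C)
    (hΔ : WeakNormLE (abkmNormParams L N Mord R p r₀ h θbar A (schedDelta δ₀ δ₁ N) 𝒞) k (K - K') CΔ)
    (hKfac : Factorises (L ^ k) K) (hK0 : ∀ φ, K ∅ φ = 1) (hK'fac : Factorises (L ^ k) K') (hK'0 : ∀ φ, K' ∅ φ = 1)
    (hKd : ∀ Y, ContDiff ℝ r₀ (K Y)) (hK'd : ∀ Y, ContDiff ℝ r₀ (K' Y))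
    (hKloc : ∀ Y, IsPolymer (L ^ k) Y → IsConn Y → IsGaugeLocal ((abkmNormParams L N Mord R p r₀ h θbar A (schedDelta δ₀ δ₁ N) 𝒞).gauge k Y) (K Y))
    (hK'loc : ∀ Y, IsPolymer (L ^ k) Y → IsConn Y → IsGaugeLocal ((abkmNormParams L N Mord R p r₀ h θbar A (schedDelta δ₀ δ₁ N) 𝒞).gauge k Y) (K' Y))
    (hKt : TransInv (L ^ k) K) (hK't : TransInv (L ^ k) K')
    (hv : pi2BoundConst d (((2 * R + 2 : ℕ) : ℝ) + ((d / 2 + 1 : ℕ) : ℝ)) * (C * A𝒫' * A⁻¹) ≤ 1 / 64)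
    {ω : ℝ}
    (hω1 : 8 * Real.exp (1 / 4) * (2 * b + pi2BoundConst d (((2 * R + 2 : ℕ) : ℝ) + ((d / 2 + 1 : ℕ) : ℝ)) * (C * A𝒫' * A⁻¹)) + 16 * Real.exp (3 / 8) * (2 * hamNorm (fieldWt h (L : ℝ) d k) ((L : ℝ) ^ k) (L ^ (d * k)) (H - H') + pi2BoundConst d (((2 * R + 2 : ℕ) : ℝ) + ((d / 2 + 1 : ℕ) : ℝ)) * (CΔ * A𝒫' * A⁻¹)) ≤ ω)
    (hω2 : 8 * Real.exp (1 / 4) * b + 16 * Real.exp (3 / 8) * hamNorm (fieldWt h (L : ℝ) d k) ((L : ℝ) ^ k) (L ^ (d * k)) (H - H') ≤ ω)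
    (hω3 : C + CΔ ≤ ω) (hωA : ω * A ^ 2 ≤ 1)
    {κ : ℝ}
    (hκ1 : 1 + Real.exp (1 / 4) + 16 * Real.exp (3 / 8) * (2 * hamNorm (fieldWt h (L : ℝ) d k) ((L : ℝ) ^ k) (L ^ (d * k)) (H - H') + pi2BoundConst d (((2 * R + 2 : ℕ) : ℝ) + ((d / 2 + 1 : ℕ) : ℝ)) * (CΔ * A𝒫' * A⁻¹)) ≤ κ)
    (hκ2 : 1 + Real.exp (1 / 4) + 16 * Real.exp (3 / 8) * (2 * b + pi2BoundConst d (((2 * R + 2 : ℕ) : ℝ) + ((d / 2 + 1 : ℕ) : ℝ)) * (C * A𝒫' * A⁻¹)) ≤ κ)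
    (hc3A : κ ^ (L ^ d) * ((2 * (2 * κ * max 1 A𝒫')) ^ ((2 ^ (d + 1) + 2) ^ d * L ^ d) * (4 : ℝ) ^ ((2 ^ (d + 1) + 2) ^ d * L ^ d)) ≤ A ^ ((1 + 1 / ((2 * (2 ^ d + 1) + 6 : ℝ) ^ d)) - 1 : ℝ))
    (hc2A : κ ^ (L ^ d) * ((2 * κ * max 1 A𝒫') ^ ((2 ^ (d + 1) + 2) ^ d * L ^ d) * (2 : ℝ) ^ ((2 ^ (d + 1) + 2) ^ d * L ^ d)) ≤ A ^ ((1 + 1 / ((2 * (2 ^ d + 1) + 6 : ℝ) ^ d)) - 1 : ℝ)) (hCΔ2 : CΔ ≤ 2 * C) :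
    WeakNormLE (abkmNormParams L N Mord R p r₀ h θbar A (schedDelta δ₀ δ₁ N) 𝒞) (k + 1) (fun U φ => nextKStep D H K U φ - nextKStep D H' K' U φ)
      ((((0 : ℝ) * ((L : ℝ) ^ d * (A𝒫' * abkmContrConst d L R) + largePartEps d L A A𝒫' (1 + 1 / ((2 * (2 ^ d + 1) + 6 : ℝ) ^ d)) + largePartEps d L A A𝒫' (1 + 1 / ((2 * (2 ^ d + 1) + 6 : ℝ) ^ d))) +
        ((L ^ d : ℕ) : ℝ) * κ ^ (L ^ d) * ((16 * Real.exp (3 / 8) * (2 * (1 : ℝ) + pi2BoundConst d (((2 * R + 2 : ℕ) : ℝ) + ((d / 2 + 1 : ℕ) : ℝ)) * ((0 : ℝ) * A𝒫' * A⁻¹))) * (((1 + 8 * pi2BoundConst d (((2 * R + 2 : ℕ) : ℝ) + ((d / 2 + 1 : ℕ) : ℝ))) * (C * A𝒫' * A⁻¹)) + 256 * Real.exp (1 / 4) * ((A𝒫' + 4) * b ^ 2 + 2 * b * (pi2BoundConst d (((2 * R + 2 : ℕ) : ℝ) + ((d / 2 + 1 : ℕ) : ℝ)) * (C * A𝒫'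 * A⁻¹)) + (pi2BoundConst d (((2 * R + 2 : ℕ) : ℝ) + ((d / 2 + 1 : ℕ) : ℝ)) * (C * A𝒫' * A⁻¹)) ^ 2)) + 16 * Real.exp (3 / 8) * (2 * b + pi2BoundConst d (((2 * R + 2 : ℕ) : ℝ) + ((d / 2 + 1 : ℕ) : ℝ)) * (C * A𝒫' * A⁻¹)) * ((1 + 8 * pi2BoundConst d (((2 * R + 2 : ℕ) : ℝ) + ((d / 2 + 1 : ℕ) : ℝ))) * ((0 : ℝ) * A𝒫' * A⁻¹)) + (512 * Real.exp (1 / 4) * (A𝒫' + 4) * (b + b) * (1 : ℝ) + 512 * Real.exp (1 / 4) * ((1 : ℝ) * (pi2BoundConst d (((2 * R + 2 : ℕ) : ℝ) + ((d / 2 + 1 : ℕ) : ℝ)) * (C * A𝒫' * A⁻¹)) + b * (pi2BoundConst d (((2 * R + 2 : ℕ) : ℝ) + ((d / 2 + 1 : ℕ) : ℝ)) * ((0 : ℝ) * A𝒫' * A⁻¹))) + 256 * Real.exp (1 / 4) * (3 * (pi2BoundConst d (((2 * R + 2 : ℕ) : ℝ) + ((d / 2 + 1 : ℕ) : ℝ))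 * (C * A𝒫' * A⁻¹))) * (pi2BoundConst d (((2 * R + 2 : ℕ) : ℝ) + ((d / 2 + 1 : ℕ) : ℝ)) * ((0 : ℝ) * A𝒫' * A⁻¹)))) * A +
        (((3 * (16 * Real.exp (3 / 8) * (2 * (1 : ℝ) + pi2BoundConst d (((2 * R + 2 : ℕ) : ℝ) + ((d / 2 + 1 : ℕ) : ℝ)) * ((0 : ℝ) * A𝒫' * A⁻¹))) + 16 * Real.exp (3 / 8) * (1 : ℝ) + (0 : ℝ)) * (ω * A ^ 4)) + (2 * (16 * Real.exp (3 / 8) * (2 * (1 : ℝ) + pi2BoundConst d (((2 * R + 2 : ℕ) : ℝ) + ((d / 2 + 1 : ℕ) : ℝ)) * ((0 : ℝ) * A𝒫' * A⁻¹))) + (0 : ℝ)) * (κ ^ (L ^ d) * ((2 * κ * max 1 A𝒫') ^ ((2 ^ (d + 1) + 2) ^ d * L ^ d) * (2 : ℝ) ^ ((2 ^ (d + 1) + 2) ^ d * L ^ d)) * A ^ (-((1 + 1 / ((2 * (2 ^ d + 1) + 6 : ℝ) ^ d)) - 1) : ℝ))) + ((3 * (16 * Real.exp (3 / 8) * (2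 * (1 : ℝ) + pi2BoundConst d (((2 * R + 2 : ℕ) : ℝ) + ((d / 2 + 1 : ℕ) : ℝ)) * ((0 : ℝ) * A𝒫' * A⁻¹))) + 16 * Real.exp (3 / 8) * (1 : ℝ) + (0 : ℝ)) * (ω * A ^ 4)) + ((3 * (16 * Real.exp (3 / 8) * (2 * (1 : ℝ) + pi2BoundConst d (((2 * R + 2 : ℕ) : ℝ) + ((d / 2 + 1 : ℕ) : ℝ)) * ((0 : ℝ) * A𝒫' * A⁻¹))) + 16 * Real.exp (3 / 8) * (1 : ℝ) + (0 : ℝ)) * (ω * A ^ 4))) +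
        ((1 : ℝ) * ((L : ℝ) ^ d * (A𝒫' * abkmContrConst d L R) + largePartEps d L A A𝒫' (1 + 1 / ((2 * (2 ^ d + 1) + 6 : ℝ) ^ d)) + largePartEps d L A A𝒫' (1 + 1 / ((2 * (2 ^ d + 1) + 6 : ℝ) ^ d))) +
        ((L ^ d : ℕ) : ℝ) * κ ^ (L ^ d) * ((16 * Real.exp (3 / 8) * (2 * (0 : ℝ) + pi2BoundConst d (((2 * R + 2 : ℕ) : ℝ) + ((d / 2 + 1 : ℕ) : ℝ)) * ((1 : ℝ) * A𝒫' * A⁻¹))) * (((1 + 8 * pi2BoundConst d (((2 * R + 2 : ℕ) : ℝ) + ((d / 2 + 1 : ℕ) : ℝ))) * (C * A𝒫' * A⁻¹)) + 256 * Real.exp (1 / 4) * ((A𝒫' + 4) * b ^ 2 + 2 * b * (pi2BoundConst d (((2 * R + 2 : ℕ) : ℝ) + ((d / 2 + 1 : ℕ) : ℝ)) * (C * A𝒫' * A⁻¹)) + (pi2BoundConst d (((2 * R + 2 : ℕ) : ℝ) + ((d / 2 + 1 : ℕ) : ℝ)) * (C * A𝒫' * A⁻¹)) ^ 2)) + 16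 * Real.exp (3 / 8) * (2 * b + pi2BoundConst d (((2 * R + 2 : ℕ) : ℝ) + ((d / 2 + 1 : ℕ) : ℝ)) * (C * A𝒫' * A⁻¹)) * ((1 + 8 * pi2BoundConst d (((2 * R + 2 : ℕ) : ℝ) + ((d / 2 + 1 : ℕ) : ℝ))) * ((1 : ℝ) * A𝒫' * A⁻¹)) + (512 * Real.exp (1 / 4) * (A𝒫' + 4) * (b + b) * (0 : ℝ) + 512 * Real.exp (1 / 4) * ((0 : ℝ) * (pi2BoundConst d (((2 * R + 2 : ℕ) : ℝ) + ((d / 2 + 1 : ℕ) : ℝ)) * (C * A𝒫' * A⁻¹)) + b * (pi2BoundConst d (((2 * R + 2 : ℕ) : ℝ) + ((d / 2 + 1 : ℕ) : ℝ)) * ((1 : ℝ) * A𝒫' * A⁻¹))) + 256 * Real.exp (1 / 4) * (3 * (pi2BoundConst d (((2 * R + 2 : ℕ) : ℝ) + ((d / 2 + 1 : ℕ) : ℝ)) * (C * A𝒫' * A⁻¹))) * (pi2BoundConst d (((2 * R + 2 : ℕ) : ℝ) + ((d / 2 + 1 : ℕ) : ℝ)) * ((1 : ℝ) * A𝒫'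 * A⁻¹)))) * A +
        (((3 * (16 * Real.exp (3 / 8) * (2 * (0 : ℝ) + pi2BoundConst d (((2 * R + 2 : ℕ) : ℝ) + ((d / 2 + 1 : ℕ) : ℝ)) * ((1 : ℝ) * A𝒫' * A⁻¹))) + 16 * Real.exp (3 / 8) * (0 : ℝ) + (1 : ℝ)) * (ω * A ^ 4)) + (2 * (16 * Real.exp (3 / 8) * (2 * (0 : ℝ) + pi2BoundConst d (((2 * R + 2 : ℕ) : ℝ) + ((d / 2 + 1 : ℕ) : ℝ)) * ((1 : ℝ) * A𝒫' * A⁻¹))) + (1 : ℝ)) * (κ ^ (L ^ d) * ((2 * κ * max 1 A𝒫') ^ ((2 ^ (d + 1) + 2) ^ d * L ^ d) * (2 : ℝ) ^ ((2 ^ (d + 1) + 2) ^ d * L ^ d)) * A ^ (-((1 + 1 / ((2 * (2 ^ d + 1) + 6 : ℝ) ^ d)) - 1) : ℝ))) + ((3 * (16 * Real.exp (3 / 8) * (2 * (0 : ℝ) + pi2BoundConst d (((2 * R + 2 : ℕ) : ℝ) + ((d / 2 + 1 : ℕ) : ℝ)) * ((1 : ℝ) * A𝒫' * A⁻¹)))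 + 16 * Real.exp (3 / 8) * (0 : ℝ) + (1 : ℝ)) * (ω * A ^ 4)) + ((3 * (16 * Real.exp (3 / 8) * (2 * (0 : ℝ) + pi2BoundConst d (((2 * R + 2 : ℕ) : ℝ) + ((d / 2 + 1 : ℕ) : ℝ)) * ((1 : ℝ) * A𝒫' * A⁻¹))) + 16 * Real.exp (3 / 8) * (0 : ℝ) + (1 : ℝ)) * (ω * A ^ 4)))) *
        max (hamNorm (fieldWt h (L : ℝ) d k) ((L : ℝ) ^ k) (L ^ (d * k)) (H - H')) CΔ) := by
  have hw := weakNormLE_nextKStep_sub_abkm_gain_of_stepKernelBounds hd hLodd hL hR2 hM hkN hp hpM hMR hr₀ hB hδ₀ hδ₁ hh hh0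
    hh2 hA𝒫 hA1 hA𝒫A hsmall D hDs hDL hS hB₀ hc₀ hH hH' hb hC hCΔ hK hK' hΔ hKfac hK0 hK'fac hK'0 hKd hK'd hKloc
    hK'loc hKt hK't hv hω1 hω2 hω3 hωA hκ1 hκ2 hc3A hc2A
  have hA0 : 0 < A := by linarith
  have hPA : 0 < (abkmNormParams L N Mord R p r₀ h θbar A (schedDelta δ₀ δ₁ N) 𝒞).A := hA0
  have hL0 : (0 : ℝ) < L := by exact_mod_cast hLodd.pos
  have h𝔥 : 0 < fieldWt h (L : ℝ) d k := fieldWt_pos hh hL0 d k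
  have hRk : (0 : ℝ) < (L : ℝ) ^ k := by positivity
  have hnn : ∀ G : RelevantHamiltonian ℂ d, 0 ≤ hamNorm (fieldWt h (L : ℝ) d k) ((L : ℝ) ^ k) (L ^ (d * k)) G :=
    fun G => hamNorm_nonneg h𝔥.le hRk.le _ _
  have hb0 : 0 ≤ b := (hnn H).trans hH
  have hC87_0 : 0 ≤ pi2BoundConst d (((2 * R + 2 : ℕ) : ℝ) + ((d / 2 + 1 : ℕ) : ℝ)) := pi2BoundConst_nonneg d (by positivity)
  have hAinv : 0 ≤ A⁻¹ := inv_nonneg.2 hA0.le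
  have hnHH0 := hnn (H - H')
  have hω0 : 0 ≤ ω := le_trans (by positivity) hω3
  have hκ0 : 0 ≤ κ := by
    have e1 : 0 ≤ 16 * Real.exp (3 / 8) * (2 * hamNorm (fieldWt h (L : ℝ) d k) ((L : ℝ) ^ k) (L ^ (d * k)) (H - H') + pi2BoundConst d (((2 * R + 2 : ℕ) : ℝ) + ((d / 2 + 1 : ℕ) : ℝ)) * (CΔ * A𝒫' * A⁻¹)) := by positivity
    linarith [hκ1, Real.exp_pos (1 / 4)]
  exact hw.mono hPA (theta_le_sigma_mul_max_gain (d := d) (R := R) hA1 hA𝒫 hC hCΔ hb0 hκ0 hω0 hLodd.pos hCΔ2)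

end Literature.MathematicalPhysics.StatisticalMechanics.GradientRG

end
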